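import Literature.Computability.FineGrained.MinPlusToNegativeTriangleProgram
import Mathlib.Tactic.IntervalCases
import HarnessLib

/-!
# Distance product `≤₃` Negative Triangle (VW–W 2018, Thm. 4.2): one detection query, verified

Semantics of the query part of the product step `psNT`
(`Literature.Computability.FineGrained.MinPlusToNegativeTriangleProgram`) of the reduction
APSP `≤₃` Negative Triangle (Vassilevska Williams–Williams, J. ACM 65 (2018), Thm. 1.1 (1) `≤₃` (3),
in print via Thm. 4.2, pp. 27:17–18), on the word RAM of
`Literature.Computability.Cryptography.WordRAM` (structured layer `SProg`/`Exec`):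

* the codes of the arcs of the tripartite query graph `QData.qmat` of
  `Literature.Computability.FineGrained.MinPlusToNegativeTriangleGadget` as computed by the program
  (`encodeWithTopInt_entryOr`, `encodeWithTopInt_tarc`, `qcode_eq`), and the query buffer as the
  encoding of the Negative-Triangle instance (`readSeg_qcode`, `QOK.inst`, `QOK.oracle_answer`:
  the oracle's answer bit is `ansOf q = [q.Witness]` by `QData.hasNegativeTriangle_qmat_iff`);
* the environment predicates of a call (`Geo`: geometry and word size from the contract
  `APSPPower.ProdSpec`; `QFacts`: the current query data; `DataQ`: the data invariant — driver
  data below the free pointer untouched, the arrays `lo`, `fd` at `F`, `F + n²`, nothing beyond the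
  workspace);
* symbolic execution of the straight-line pieces (`arcXY_spec`, `arcT_spec`, `decodeCell_spec`,
  `guard_spec`, `sel_spec`, `write_spec`), one cell (`cellBody_spec`, `95` steps), the cell loop
  (`cellLoop_spec`) and **one detection query end to end** (`ask_spec`: the query log grows by
  exactly the encoding of the instance `q.qmat` of size `3L`, the answer bit lands in `r49`, within
  `tAsk L = 97 · 9L² + 7` steps).

Proof technique: the block/loop rules of `…WordRAMStructured(Blocks)` (`Exec.block_of_fwd`,
`execOps_cons_fwd`, `ExecLE.whilenz_invariant`), registers below `100` kept symbolic
(`merge S H`), frame conditions stated per register range.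

## References

* V. Vassilevska Williams, R. R. Williams, *Subcubic equivalences between path, matrix, and
  triangle problems*, J. ACM 65 (2018), Art. 27: Thm. 4.2 (p. 27:14; proof pp. 27:17–18),
  Lemma 4.2 (p. 27:16). doi:10.1145/3186893
* T. Nipkow, G. Klein, *Concrete Semantics with Isabelle/HOL*, Springer 2014, §7, §12.
-/

namespace Literature.Computability.FineGrained.NegTriStep

open Cryptography Cryptography.WordRAM Cryptography.WordRAM.SProg Matrix APSPPower

/-! ## Codes of the arcs of the query graph -/

/-- The code of a nonnegative integer weight `k` is `2k + 1`. [folklore] -/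
theorem encodeWithTopInt_natCast (k : ℕ) : encodeWithTopInt (((k : ℤ) : ℤ) : WithTop ℤ) = 2 * k + 1 := by
  simp [encodeWithTopInt]

/-- The code of the integer weight `a - s` (`a, s : ℕ`): `2 (s - a)` if negative, `2 (a - s) + 1`
otherwise. [folklore] -/
theorem encodeWithTopInt_sub (a s : ℕ) :
    encodeWithTopInt ((((a : ℤ) - s : ℤ)) : WithTop ℤ) = if a < s then 2 * (s - a) else 2 * (a - s) + 1 := by
  by_cases h : a < s
  · rw [if_pos h]
    obtain ⟨k, hk⟩ : ∃ k, s = a + k + 1 := ⟨s - a - 1, by omega⟩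
    subst hk
    have : ((a : ℤ) - (a + k + 1 : ℕ) : ℤ) = Int.negSucc k := by
      rw [Int.negSucc_eq]; push_cast; ring
    rw [this]
    simp [encodeWithTopInt]
    omega
  · rw [if_neg h]
    obtain ⟨k, hk⟩ : ∃ k, a = s + k := ⟨a - s, by omega⟩
    subst hk
    have : ((s + k : ℕ) - (s : ℤ) : ℤ) = (k : ℕ) := by push_cast; ring
    rw [this, encodeWithTopInt_natCast]
    simp

/-- The code of the non-edge weight. [folklore] -/
theorem encodeWithTopInt_big (M : ℕ) : encodeWithTopInt (((big M : ℕ) : ℤ) : WithTop ℤ) = 2 * big M + 1 :=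
  encodeWithTopInt_natCast _

variable {n : ℕ}

/-- **The code of an operand arc** (`QData.entryOr`): the stored code of the entry when the indices
are in range and the entry is finite (nonzero code), the non-edge code otherwise. [folklore] -/
theorem encodeWithTopInt_entryOr (Z : Matrix (Fin n) (Fin n) (WithTop ℤ)) (M a b : ℕ) :
    encodeWithTopInt ((QData.entryOr Z M a b : ℤ) : WithTop ℤ) =
      if h : a < n ∧ b < n then
        (if encodeWithTopInt (Z ⟨a, h.1⟩ ⟨b, h.2⟩) = 0 then 2 * big M + 1
          else encodeWithTopInt (Z ⟨a, h.1⟩ ⟨b, h.2⟩))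
      else 2 * big M + 1 := by
  unfold QData.entryOr
  by_cases h : a < n ∧ b < n
  · rw [dif_pos h, dif_pos h]
    cases hZ : Z ⟨a, h.1⟩ ⟨b, h.2⟩ with
    | top => simp [encodeWithTopInt]
    | coe z =>
      simp only []
      rw [if_neg (NegTriToAPSP.encodeWithTopInt_coe_ne_zero z)]
  · rw [dif_neg h, dif_neg h, encodeWithTopInt_big]

/-- **The code of a back arc** (`QData.tarc`): for an active pair the code of `2M - (lo + pw)`, the
non-edge code otherwise. [folklore] -/
theorem encodeWithTopInt_tarc (q : QData n) (iu iv : ℕ) :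
    encodeWithTopInt ((q.tarc iu iv : ℤ) : WithTop ℤ) =
      if q.Active iu iv then
        (if 2 * q.M < q.lo ((q.bi * q.L + iv) * n + (q.bj * q.L + iu)) + q.pw then
            2 * (q.lo ((q.bi * q.L + iv) * n + (q.bj * q.L + iu)) + q.pw - 2 * q.M)
          else 2 * (2 * q.M - (q.lo ((q.bi * q.L + iv) * n + (q.bj * q.L + iu)) + q.pw)) + 1)
      else 2 * big q.M + 1 := by
  unfold QData.tarc
  split_ifs with ha
  · have := encodeWithTopInt_sub (2 * q.M) (q.lo ((q.bi * q.L + iv) * n + (q.bj * q.L + iu)) + q.pw)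
    push_cast at this ⊢
    rw [this, if_pos (by assumption)]
  · have := encodeWithTopInt_sub (2 * q.M) (q.lo ((q.bi * q.L + iv) * n + (q.bj * q.L + iu)) + q.pw)
    push_cast at this ⊢
    rw [this, if_neg (by assumption)]
  · exact encodeWithTopInt_big _

/-- The code of cell `m` (row-major, row length `3L`) of the query matrix. [folklore] -/
def qcode (q : QData n) (m : ℕ) : ℕ :=
  encodeWithTopInt ((q.qmatN (m / (3 * q.L)) (m % (3 * q.L)) : ℤ) : WithTop ℤ)

/-- **Dispatch on the selector.** With `u = m / 3L`, `v = m mod 3L` and `sel = 3 (u / L) + v / L`,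
the code of cell `m` is that of an `X`-arc if `sel = 1`, of a `Y`-arc if `sel = 5`, of a back arc
if `sel = 6`, and the non-edge code otherwise. [folklore] -/
theorem qcode_eq (q : QData n) (hL : 0 < q.L) {m : ℕ} (hm : m < 9 * (q.L * q.L)) :
    qcode q m =
      if 3 * (m / (3 * q.L) / q.L) + m % (3 * q.L) / q.L = 1 then
        encodeWithTopInt ((q.xarc (m / (3 * q.L) % q.L) (m % (3 * q.L) % q.L) : ℤ) : WithTop ℤ)
      else if 3 * (m / (3 * q.L) / q.L) + m % (3 * q.L) / q.L = 5 then
        encodeWithTopInt ((q.yarc (m / (3 * q.L) % q.L) (m % (3 * q.L) % q.L) : ℤ) : WithTop ℤ)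
      else if 3 * (m / (3 * q.L) / q.L) + m % (3 * q.L) / q.L = 6 then
        encodeWithTopInt ((q.tarc (m / (3 * q.L) % q.L) (m % (3 * q.L) % q.L) : ℤ) : WithTop ℤ)
      else 2 * big q.M + 1 := by
  have h3L : 0 < 3 * q.L := by omega
  have hu : m / (3 * q.L) < 3 * q.L := Nat.div_lt_of_lt_mul (by nlinarith)
  have hv : m % (3 * q.L) < 3 * q.L := Nat.mod_lt _ h3L
  have hpu : m / (3 * q.L) / q.L < 3 := Nat.div_lt_of_lt_mul (by linarith)
  have hpv : m % (3 * q.L) / q.L < 3 := Nat.div_lt_of_lt_mul (by linarith)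
  unfold qcode QData.qmatN
  generalize m / (3 * q.L) / q.L = pu at hpu ⊢
  generalize m % (3 * q.L) / q.L = pv at hpv ⊢
  interval_cases pu <;> interval_cases pv <;> simp <;> exact encodeWithTopInt_big _

/-- **The query buffer is the encoding of the query graph**: header `3L` followed by the codes of the
`9L²` cells. [folklore] -/
theorem readSeg_qcode {H : ℕ → ℕ} {pQ : ℕ} (q : QData n) (hh : H pQ = 3 * q.L)
    (hc : ∀ m, m < 9 * (q.L * q.L) → H (pQ + 1 + m) = qcode q m) :
    readSeg H pQ (9 * (q.L * q.L) + 1) = encodeMatrixWithTop (q.qmat.map ((↑) : ℤ → WithTop ℤ)) := by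
  have h9 : 3 * q.L * (3 * q.L) = 9 * (q.L * q.L) := by ring
  have hlen : (encodeMatrixWithTop (q.qmat.map ((↑) : ℤ → WithTop ℤ))).length = 9 * (q.L * q.L) + 1 := by
    rw [encodeMatrixWithTop_length, sq, h9]
  refine readSeg_eq_of_forall hlen fun j hj => ?_
  rcases j with _ | m
  · rw [Nat.add_zero, hh, NegTriToAPSP.getElem_encodeMatrixWithTop_zero]
  · have hm : m < 3 * q.L * (3 * q.L) := by rw [h9]; omega
    rw [show pQ + (m + 1) = pQ + 1 + m by omega, hc m (by omega),
      NegTriToAPSP.getElem_encodeMatrixWithTop_succ _ m hm]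
    rfl

/-! ## The query as a Negative-Triangle instance -/

section Instance

variable (c' : ℕ) (q : QData n)

/-- The hypotheses making the query graph a well-formed instance whose negative triangles are the
witnesses: bounded operands, thresholds at most `8M + 2`, a positive block side, and the weight
exponent `c'` of the oracle problem accommodating the non-edge weight. [folklore] -/
structure QOK : Prop where
  hX : HasBoundedWeights q.X q.M
  hY : HasBoundedWeights q.Y q.M
  hlo : ∀ t, t < n * n → q.lo t + q.pw ≤ 8 * q.M + 2
  hL : 0 < q.L
  hbig : big q.M ≤ (3 * q.L) ^ c'

variable {c' q}

/-- The query graph is a `NegativeTriangle c'` instance. [folklore] -/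
theorem QOK.hasBoundedWeights (h : QOK c' q) :
    HasBoundedWeights (q.qmat.map ((↑) : ℤ → WithTop ℤ)) ((3 * q.L) ^ c') := fun u v =>
  IsBddWeight.mono (q.hasBoundedWeights_qmat h.hX h.hY h.hlo u v) h.hbig

/-- The instance handed to the oracle. [folklore] -/
noncomputable def QOK.inst (h : QOK c' q) : (NegativeTriangle c').Inst :=
  ⟨⟨3 * q.L, q.qmat⟩, h.hasBoundedWeights⟩

/-- Its encoding is the encoding of the query graph. [folklore] -/
theorem QOK.encode_inst (h : QOK c' q) :
    (NegativeTriangle c').encode h.inst = encodeMatrixWithTop (q.qmat.map ((↑) : ℤ → WithTop ℤ)) := rfl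

/-- Its size is `3L`. [folklore] -/
theorem QOK.size_inst (h : QOK c' q) : (NegativeTriangle c').size h.inst = 3 * q.L := rfl

/-- Its encoding has length `9L² + 1`. [folklore] -/
theorem QOK.length_encode_inst (h : QOK c' q) :
    ((NegativeTriangle c').encode h.inst).length = 9 * (q.L * q.L) + 1 := by
  rw [h.encode_inst, encodeMatrixWithTop_length]; ring

open Classical in
/-- The answer bit of the query: `1` iff the query graph has a witness. [folklore] -/
noncomputable def ansOf (q : QData n) : ℕ := if q.Witness then 1 else 0

/-- The answer bit is at most `1`. [folklore] -/
theorem ansOf_le_one (q : QData n) : ansOf q ≤ 1 := by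
  unfold ansOf; split_ifs <;> simp

/-- The answer bit is nonzero iff there is a witness. [folklore] -/
theorem ansOf_ne_zero_iff (q : QData n) : ansOf q ≠ 0 ↔ q.Witness := by
  unfold ansOf; split_ifs with h <;> simp [h]

/-- **The oracle's answer** to the query is the answer bit (by `QData.hasNegativeTriangle_qmat_iff`). [folklore] -/
theorem QOK.oracle_answer (h : QOK c' q) {O : List ℕ → List ℕ} (hO : (NegativeTriangle c').OracleAnswers O) :
    O (encodeMatrixWithTop (q.qmat.map ((↑) : ℤ → WithTop ℤ))) = [ansOf q] := by
  have := hO h.inst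
  rw [h.encode_inst] at this
  have hiff := q.hasNegativeTriangle_qmat_iff h.hX h.hY h.hlo h.hL
  unfold ansOf
  by_cases hw : q.Witness
  · have hnt : HasNegativeTriangle q.qmat := hiff.2 hw
    simp only [NegativeTriangle, FGProblem.restrict, FGProblem.ofPred, QOK.inst, hnt, if_true,
      Set.mem_singleton_iff] at this
    rw [this, if_pos hw]
  · have hnt : ¬ HasNegativeTriangle q.qmat := fun h' => hw (hiff.1 h')
    simp only [NegativeTriangle, FGProblem.restrict, FGProblem.ofPred, QOK.inst, hnt, if_false,
      Set.mem_singleton_iff] at this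
    rw [this, if_neg hw]

end Instance


/-! ## Flags -/

/-- `a b ≤ 1` for `a, b ≤ 1`. [folklore] -/
theorem mul_le_one_of_le_one {a b : ℕ} (ha : a ≤ 1) (hb : b ≤ 1) : a * b ≤ 1 := by
  calc a * b ≤ 1 * 1 := Nat.mul_le_mul ha hb
    _ = 1 := rfl

/-- Conjunction of flags is their product. [folklore] -/
theorem ite_mul_ite (p q : Prop) [Decidable p] [Decidable q] :
    (if p then 1 else 0) * (if q then 1 else 0) = if p ∧ q then 1 else 0 := by
  by_cases hp : p <;> by_cases hq : q <;> simp [hp, hq]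

/-- Negation of a flag is its complement to `1`. [folklore] -/
theorem one_sub_ite (p : Prop) [Decidable p] : 1 - (if p then 1 else 0) = if ¬ p then 1 else 0 := by
  by_cases hp : p <;> simp [hp]

/-- The code of an `M`-bounded weight is below the non-edge code `2 big M + 1`. [folklore] -/
theorem code_lt_of_isBddWeight {M : ℕ} {a : WithTop ℤ} (h : IsBddWeight M a) :
    encodeWithTopInt a < 2 * big M + 1 := by
  have := encodeWithTopInt_le_of_isBddWeight h
  unfold big; omega

/-! ## The environment of a call -/

/-- **The geometry of a call** (from the contract `ProdSpec`): `n ≥ 1`, the operand blocks at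
`pX ≥ 100` and `pY = pX + n² + 1` below the free pointer `F`, and a word size accommodating the
workspace, the codes (up to the non-edge code `2 big M + 1`) and `n³`. [folklore] -/
structure Geo (n w F pX pY M : ℕ) : Prop where
  hn : 1 ≤ n
  hpX : 100 ≤ pX
  hpY : pY = pX + n * n + 1
  hpYF : pY + n * n < F
  hFw : F + wspNT n < 2 ^ w
  hMw : 2 * big M + 1 < 2 ^ w
  hn3w : n * n * n < 2 ^ w

variable {n : ℕ}

/-- **The facts about the current query data** `q`: a well-formed instance (`QOK`), the block
side is `cubeRt n`, the blocks are in range, the windows lie inside the block, and the operands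
are stored as code blocks at `pX`, `pY` in the data `H₀` handed over by the driver. [folklore] -/
structure QFacts (c' : ℕ) (q : QData n) (pX pY : ℕ) (H₀ : ℕ → ℕ) : Prop where
  ok : QOK c' q
  hL : q.L = cubeRt n
  hbi : q.bi < nblk n
  hbj : q.bj < nblk n
  hbk : q.bk < nblk n
  hrhi : q.rhi ≤ q.L
  hchi : q.chi ≤ q.L
  hX0 : MatAt H₀ pX q.X
  hY0 : MatAt H₀ pY q.Y

/-- **The data during the rounds**: below the free pointer `F` the driver's data `H₀` untouched;
the arrays of lower bounds and found stamps at `F` and `F + n²`; nothing from `F + wspNT n` on.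
(The query buffer and the answer words in between are unconstrained.) [folklore] -/
structure DataQ (q : QData n) (F : ℕ) (H₀ H : ℕ → ℕ) : Prop where
  below : ∀ a, a < F → H a = H₀ a
  lo : ∀ t, t < n * n → H (F + t) = q.lo t
  fd : ∀ t, t < n * n → H (F + n * n + t) = q.fd t
  zero : ∀ a, F + wspNT n ≤ a → H a = 0

/-- Writing inside the query buffer or the answer words keeps the data invariant. [folklore] -/
theorem DataQ.update {q : QData n} {F : ℕ} {H₀ H : ℕ → ℕ} (h : DataQ q F H₀ H) {a : ℕ}
    (ha : F + 2 * (n * n) ≤ a) (ha' : a < F + wspNT n) (v : ℕ) : DataQ q F H₀ (Function.update H a v) where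
  below b hb := by rw [Function.update_of_ne (by omega)]; exact h.below b hb
  lo t ht := by rw [Function.update_of_ne (by omega)]; exact h.lo t ht
  fd t ht := by rw [Function.update_of_ne (by omega)]; exact h.fd t ht
  zero b hb := by rw [Function.update_of_ne (by omega)]; exact h.zero b hb

/-- The data invariant does not depend on the windows. [folklore] -/
theorem DataQ.setWin {q : QData n} {F : ℕ} {H₀ H : ℕ → ℕ} (h : DataQ q F H₀ H) (a b c d : ℕ) :
    DataQ (q.setWin a b c d) F H₀ H :=
  ⟨h.below, h.lo, h.fd, h.zero⟩

/-- The data invariant after stamping one pair as found. [folklore] -/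
theorem DataQ.mark {q : QData n} {F : ℕ} {H₀ H : ℕ → ℕ} (h : DataQ q F H₀ H) {t : ℕ} (ht : t < n * n)
    (hw : 2 * (n * n) ≤ wspNT n) :
    DataQ { q with fd := Function.update q.fd t q.pw } F H₀ (Function.update H (F + n * n + t) q.pw) where
  below b hb := by rw [Function.update_of_ne (by omega)]; exact h.below b hb
  lo s hs := by rw [Function.update_of_ne (by omega)]; exact h.lo s hs
  fd s hs := by
    show Function.update H (F + n * n + t) q.pw (F + n * n + s) = Function.update q.fd t q.pw s
    by_cases hst : s = t
    · subst hst; rw [Function.update_self, Function.update_self]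
    · rw [Function.update_of_ne (by omega), Function.update_of_ne hst]; exact h.fd s hs
  zero b hb := by rw [Function.update_of_ne (by omega)]; exact h.zero b hb

section Arcs

variable {w : ℕ} {O : List ℕ → List ℕ} {F pX pY M : ℕ}

set_option linter.unusedSimpArgs false in
/-- **The code of an operand arc.** With the blocks `rb = r71`, `cb = r72`, local indices
`iu = r65`, `iv = r67`, an operand `Z` stored (as codes) at `pZ` with `r73 = pZ + 1`, and the
non-edge code in `r69`, `arcXY` leaves in `r69` the code of the arc weight
`QData.entryOr Z M (rb L + iu) (cb L + iv)` within `16` steps, touching only `r69, r74 … r79`. [folklore] -/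
theorem arcXY_spec (hG : Geo n w F pX pY M) {S H : ℕ → ℕ} {qs : List (List ℕ)}
    {Z : Matrix (Fin n) (Fin n) (WithTop ℤ)} {L rb cb iu iv pZ : ℕ}
    (hZ : MatAt H pZ Z) (hbZ : HasBoundedWeights Z M) (hpZ : 100 ≤ pZ) (hpZF : pZ + 1 + n * n ≤ F)
    (hrb : rb * L < n) (hcb : cb * L < n) (hiu : iu < L) (hiv : iv < L) (hLn : L ≤ n)
    (h2 : S 2 = n) (h25 : S 25 = L) (h65 : S 65 = iu) (h67 : S 67 = iv) (h69 : S 69 = 2 * big M + 1)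
    (h71 : S 71 = rb) (h72 : S 72 = cb) (h73 : S 73 = pZ + 1) :
    ∃ S', ExecLE w O arcXY ⟨merge S H, qs⟩ ⟨merge S' H, qs⟩ 16 ∧
      S' 69 = encodeWithTopInt ((QData.entryOr Z M (rb * L + iu) (cb * L + iv) : ℤ) : WithTop ℤ) ∧
      ∀ r, r ≠ 69 → r < 74 ∨ 79 < r → S' r = S r := by
  obtain ⟨hn, hpX, hpY, hpYF, hFw, hMw, hn3w⟩ := hG
  have hnn : n ≤ n * n := Nat.le_mul_self n
  -- block 1: indices and range flags
  obtain ⟨st₁, hex₁, S₁, rfl, h74, h75, h77, hS₁⟩ : ∃ st₁, Exec w O (block arcXYOps1) ⟨merge S H, qs⟩ st₁ 7 ∧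
      ∃ S₁, st₁ = ⟨merge S₁ H, qs⟩ ∧ S₁ 74 = rb * L + iu ∧ S₁ 75 = cb * L + iv ∧
        S₁ 77 = (if rb * L + iu < n then 1 else 0) * (if cb * L + iv < n then 1 else 0) ∧
        ∀ r, r < 74 ∨ 77 < r → S₁ r = S r := by
    refine Exec.block_of_fwd _ _ fun R hR => ?_
    unfold arcXYOps1 at hR
    have htmp := execOps_cons_fwd hR; clear hR; obtain ⟨v1, hv1, hR⟩ := htmp
    simp -failIfUnchanged (disch := omega) only [Operand.write, Operand.read, merge_apply_of_lt,
        merge_apply_of_le, Function.update_self, Function.update_of_ne, update_merge_of_lt,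
        update_merge_of_le, Nat.add_zero, BinOp.eval_mod, BinOp.eval_eq, BinOp.eval_band,
        BinOp.eval_shr, BinOp.eval_div, BinOp.eval_lt, BinOp.eval_add_of_lt, BinOp.eval_sub_of_le,
        BinOp.eval_mul_of_lt, h2, h25, h65, h67, h71, h72] at hv1 hR; subst hv1
    have htmp := execOps_cons_fwd hR; clear hR; obtain ⟨v2, hv2, hR⟩ := htmp
    simp -failIfUnchanged (disch := omega) only [Operand.write, Operand.read, merge_apply_of_lt,
        merge_apply_of_le, Function.update_self, Function.update_of_ne, update_merge_of_lt,
        update_merge_of_le, Nat.add_zero, BinOp.eval_mod, BinOp.eval_eq, BinOp.eval_band,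
        BinOp.eval_shr, BinOp.eval_div, BinOp.eval_lt, BinOp.eval_add_of_lt, BinOp.eval_sub_of_le,
        BinOp.eval_mul_of_lt, h2, h25, h65, h67, h71, h72] at hv2 hR; subst hv2
    have htmp := execOps_cons_fwd hR; clear hR; obtain ⟨v3, hv3, hR⟩ := htmp
    simp -failIfUnchanged (disch := omega) only [Operand.write, Operand.read, merge_apply_of_lt,
        merge_apply_of_le, Function.update_self, Function.update_of_ne, update_merge_of_lt,
        update_merge_of_le, Nat.add_zero, BinOp.eval_mod, BinOp.eval_eq, BinOp.eval_band,
        BinOp.eval_shr, BinOp.eval_div, BinOp.eval_lt, BinOp.eval_add_of_lt, BinOp.eval_sub_of_le,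
        BinOp.eval_mul_of_lt, h2, h25, h65, h67, h71, h72] at hv3 hR; subst hv3
    have htmp := execOps_cons_fwd hR; clear hR; obtain ⟨v4, hv4, hR⟩ := htmp
    simp -failIfUnchanged (disch := omega) only [Operand.write, Operand.read, merge_apply_of_lt,
        merge_apply_of_le, Function.update_self, Function.update_of_ne, update_merge_of_lt,
        update_merge_of_le, Nat.add_zero, BinOp.eval_mod, BinOp.eval_eq, BinOp.eval_band,
        BinOp.eval_shr, BinOp.eval_div, BinOp.eval_lt, BinOp.eval_add_of_lt, BinOp.eval_sub_of_le,
        BinOp.eval_mul_of_lt, h2, h25, h65, h67, h71, h72] at hv4 hR; subst hv4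
    have htmp := execOps_cons_fwd hR; clear hR; obtain ⟨v5, hv5, hR⟩ := htmp
    simp -failIfUnchanged (disch := omega) only [Operand.write, Operand.read, merge_apply_of_lt,
        merge_apply_of_le, Function.update_self, Function.update_of_ne, update_merge_of_lt,
        update_merge_of_le, Nat.add_zero, BinOp.eval_mod, BinOp.eval_eq, BinOp.eval_band,
        BinOp.eval_shr, BinOp.eval_div, BinOp.eval_lt, BinOp.eval_add_of_lt, BinOp.eval_sub_of_le,
        BinOp.eval_mul_of_lt, h2, h25, h65, h67, h71, h72] at hv5 hR
    have htmp := execOps_cons_fwd hR; clear hR; obtain ⟨v6, hv6, hR⟩ := htmp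
    simp -failIfUnchanged (disch := omega) only [Operand.write, Operand.read, merge_apply_of_lt,
        merge_apply_of_le, Function.update_self, Function.update_of_ne, update_merge_of_lt,
        update_merge_of_le, Nat.add_zero, BinOp.eval_mod, BinOp.eval_eq, BinOp.eval_band,
        BinOp.eval_shr, BinOp.eval_div, BinOp.eval_lt, BinOp.eval_add_of_lt, BinOp.eval_sub_of_le,
        BinOp.eval_mul_of_lt, h2, h25, h65, h67, h71, h72] at hv6 hR
    have hv56 : v5 * v6 ≤ 1 := mul_le_one_of_le_one (hv5 ▸ NegTriToAPSP.ite_le_one _) (hv6 ▸ NegTriToAPSP.ite_le_one _)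
    have htmp := execOps_cons_fwd hR; clear hR; obtain ⟨v7, hv7, hR⟩ := htmp
    simp -failIfUnchanged (disch := omega) only [Operand.write, Operand.read, merge_apply_of_lt,
        merge_apply_of_le, Function.update_self, Function.update_of_ne, update_merge_of_lt,
        update_merge_of_le, Nat.add_zero, BinOp.eval_mod, BinOp.eval_eq, BinOp.eval_band,
        BinOp.eval_shr, BinOp.eval_div, BinOp.eval_lt, BinOp.eval_add_of_lt, BinOp.eval_sub_of_le,
        BinOp.eval_mul_of_lt, h2, h25, h65, h67, h71, h72] at hv7 hR
    simp only [execOps_nil] at hR; subst hR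
    refine ⟨_, rfl, by simp, by simp, ?_, fun r hr => ?_⟩
    · simp only [Function.update_self]; rw [← hv7, ← hv5, ← hv6]
    · rw [Function.update_of_ne (by omega), Function.update_of_ne (by omega),
        Function.update_of_ne (by omega), Function.update_of_ne (by omega),
        Function.update_of_ne (by omega), Function.update_of_ne (by omega),
        Function.update_of_ne (by omega)]
  have h2₁ : S₁ 2 = n := (hS₁ 2 (by omega)).trans h2
  have h73₁ : S₁ 73 = pZ + 1 := (hS₁ 73 (by omega)).trans h73
  have h69₁ : S₁ 69 = 2 * big M + 1 := (hS₁ 69 (by omega)).trans h69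
  by_cases hcc : rb * L + iu < n ∧ cb * L + iv < n
  · -- in range: fetch the stored code
    have h77' : (Operand.dir 77).read (merge S₁ H) ≠ 0 := by
      rw [Operand.read_dir_merge (by norm_num), h77]; simp [hcc.1, hcc.2]
    have hidx : (rb * L + iu) * n + (cb * L + iv) < n * n := NegTriToAPSP.mul_add_lt_mul hcc.1 hcc.2
    have hcx : H ((rb * L + iu) * n + (cb * L + iv) + (pZ + 1)) =
        encodeWithTopInt (Z ⟨_, hcc.1⟩ ⟨_, hcc.2⟩) := by
      rw [Nat.add_comm]; exact hZ ⟨_, hcc.1⟩ ⟨_, hcc.2⟩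
    have hcxw : encodeWithTopInt (Z ⟨_, hcc.1⟩ ⟨_, hcc.2⟩) < 2 ^ w :=
      lt_trans (code_lt_of_isBddWeight (hbZ _ _)) hMw
    obtain ⟨st₂, hex₂, S₂, rfl, h79, hS₂⟩ : ∃ st₂, Exec w O (block arcXYOps2) ⟨merge S₁ H, qs⟩ st₂ 4 ∧
        ∃ S₂, st₂ = ⟨merge S₂ H, qs⟩ ∧ S₂ 79 = encodeWithTopInt (Z ⟨_, hcc.1⟩ ⟨_, hcc.2⟩) ∧
          ∀ r, r < 78 ∨ 79 < r → S₂ r = S₁ r := by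
      refine Exec.block_of_fwd _ _ fun R hR => ?_
      unfold arcXYOps2 at hR
      have htmp := execOps_cons_fwd hR; clear hR; obtain ⟨v1, hv1, hR⟩ := htmp
      simp -failIfUnchanged (disch := omega) only [Operand.write, Operand.read, merge_apply_of_lt,
          merge_apply_of_le, Function.update_self, Function.update_of_ne, update_merge_of_lt,
          update_merge_of_le, Nat.add_zero, BinOp.eval_mod, BinOp.eval_eq, BinOp.eval_band,
          BinOp.eval_shr, BinOp.eval_div, BinOp.eval_lt, BinOp.eval_add_of_lt, BinOp.eval_sub_of_le,
          BinOp.eval_mul_of_lt, h2₁, h73₁, h74, h75, hcx] at hv1 hR; subst hv1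
      have htmp := execOps_cons_fwd hR; clear hR; obtain ⟨v2, hv2, hR⟩ := htmp
      simp -failIfUnchanged (disch := omega) only [Operand.write, Operand.read, merge_apply_of_lt,
          merge_apply_of_le, Function.update_self, Function.update_of_ne, update_merge_of_lt,
          update_merge_of_le, Nat.add_zero, BinOp.eval_mod, BinOp.eval_eq, BinOp.eval_band,
          BinOp.eval_shr, BinOp.eval_div, BinOp.eval_lt, BinOp.eval_add_of_lt, BinOp.eval_sub_of_le,
          BinOp.eval_mul_of_lt, h2₁, h73₁, h74, h75, hcx] at hv2 hR; subst hv2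
      have htmp := execOps_cons_fwd hR; clear hR; obtain ⟨v3, hv3, hR⟩ := htmp
      simp -failIfUnchanged (disch := omega) only [Operand.write, Operand.read, merge_apply_of_lt,
          merge_apply_of_le, Function.update_self, Function.update_of_ne, update_merge_of_lt,
          update_merge_of_le, Nat.add_zero, BinOp.eval_mod, BinOp.eval_eq, BinOp.eval_band,
          BinOp.eval_shr, BinOp.eval_div, BinOp.eval_lt, BinOp.eval_add_of_lt, BinOp.eval_sub_of_le,
          BinOp.eval_mul_of_lt, h2₁, h73₁, h74, h75, hcx] at hv3 hR; subst hv3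
      have htmp := execOps_cons_fwd hR; clear hR; obtain ⟨v4, hv4, hR⟩ := htmp
      simp -failIfUnchanged (disch := omega) only [Operand.write, Operand.read, merge_apply_of_lt,
          merge_apply_of_le, Function.update_self, Function.update_of_ne, update_merge_of_lt,
          update_merge_of_le, Nat.add_zero, BinOp.eval_mod, BinOp.eval_eq, BinOp.eval_band,
          BinOp.eval_shr, BinOp.eval_div, BinOp.eval_lt, BinOp.eval_add_of_lt, BinOp.eval_sub_of_le,
          BinOp.eval_mul_of_lt, h2₁, h73₁, h74, h75, hcx] at hv4 hR; subst hv4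
      simp only [execOps_nil] at hR; subst hR
      refine ⟨_, rfl, by simp, fun r hr => ?_⟩
      rw [Function.update_of_ne (by omega), Function.update_of_ne (by omega),
        Function.update_of_ne (by omega), Function.update_of_ne (by omega)]
    by_cases hz : encodeWithTopInt (Z ⟨_, hcc.1⟩ ⟨_, hcc.2⟩) = 0
    · -- an infinite entry: keep the non-edge code
      have h79' : (Operand.dir 79).read (merge S₂ H) = 0 := by
        rw [Operand.read_dir_merge (by norm_num), h79, hz]
      refine ⟨S₂, ?_, ?_, fun r hr hr' => ?_⟩
      · exact (hex₁.execLE.seq (ExecLE.ifz_ne h77'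
          (hex₂.execLE.seq (ExecLE.ifz_zero h79' (ExecLE.skip _ 0))))).mono (by norm_num)
      · rw [hS₂ 69 (by omega), h69₁, encodeWithTopInt_entryOr, dif_pos hcc, if_pos hz]
      · rw [hS₂ r (by omega), hS₁ r (by omega)]
    · -- a finite entry: its stored code
      have h79' : (Operand.dir 79).read (merge S₂ H) ≠ 0 := by
        rw [Operand.read_dir_merge (by norm_num), h79]; exact hz
      have hexo := Exec.op_dir' (w := w) (O := O) (d := 69) (by norm_num) (o := .add) (x := .dir 79)
        (y := .imm 0) (S := S₂) (H := H) (qs := qs) (v := encodeWithTopInt (Z ⟨_, hcc.1⟩ ⟨_, hcc.2⟩))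
        (by rw [Operand.read_dir_merge (by norm_num), Operand.read_imm, h79,
              BinOp.eval_add_of_lt (by omega), Nat.add_zero])
      refine ⟨Function.update S₂ 69 (encodeWithTopInt (Z ⟨_, hcc.1⟩ ⟨_, hcc.2⟩)), ?_, ?_, fun r hr hr' => ?_⟩
      · exact (hex₁.execLE.seq (ExecLE.ifz_ne h77'
          (hex₂.execLE.seq (ExecLE.ifz_ne h79' hexo.execLE)))).mono (by norm_num)
      · rw [Function.update_self, encodeWithTopInt_entryOr, dif_pos hcc, if_neg hz]
      · rw [Function.update_of_ne hr, hS₂ r (by omega), hS₁ r (by omega)]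
  · -- out of range: keep the non-edge code
    have h77' : (Operand.dir 77).read (merge S₁ H) = 0 := by
      rw [Operand.read_dir_merge (by norm_num), h77]
      by_cases h1 : rb * L + iu < n
      · have h2' : ¬ cb * L + iv < n := fun h2' => hcc ⟨h1, h2'⟩
        simp [h2']
      · simp [h1]
    refine ⟨S₁, (hex₁.execLE.seq (ExecLE.ifz_zero h77' (ExecLE.skip _ 0))).mono (by norm_num), ?_,
      fun r hr hr' => hS₁ r (by omega)⟩
    rw [h69₁, encodeWithTopInt_entryOr, dif_neg hcc]

set_option linter.unusedSimpArgs false in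
/-- **The code of a back arc.** With the triple and windows in `r42 … r48`, local column `iu = r65`,
local row `iv = r67`, the arrays `lo`, `fd` of `q` at `F`, `F + n²` and the non-edge code in
`r69`, `arcT` leaves in `r69` the code of `q.tarc iu iv` within `35` steps, touching only
`r69, r74 … r84`. [folklore] -/
theorem arcT_spec {c' : ℕ} {q : QData n} (hG : Geo n w F pX pY q.M) {H₀ : ℕ → ℕ} (hok : QOK c' q)
    {S H : ℕ → ℕ} {qs : List (List ℕ)} {iu iv : ℕ} (hD : DataQ q F H₀ H)
    (hfdb : ∀ t, t < n * n → q.fd t ≤ 8 * q.M + 2)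
    (hbi : q.bi * q.L < n) (hbj : q.bj * q.L < n) (hiu : iu < q.L) (hiv : iv < q.L) (hLn : q.L ≤ n)
    (h2 : S 2 = n) (h21 : S 21 = 2 * q.M) (h24 : S 24 = q.pw) (h25 : S 25 = q.L) (h31 : S 31 = F)
    (h32 : S 32 = F + n * n) (h42 : S 42 = q.bi) (h43 : S 43 = q.bj) (h45 : S 45 = q.rlo)
    (h46 : S 46 = q.rhi) (h47 : S 47 = q.clo) (h48 : S 48 = q.chi) (h65 : S 65 = iu) (h67 : S 67 = iv)
    (h69 : S 69 = 2 * big q.M + 1) :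
    ∃ S', ExecLE w O arcT ⟨merge S H, qs⟩ ⟨merge S' H, qs⟩ 35 ∧
      S' 69 = encodeWithTopInt ((q.tarc iu iv : ℤ) : WithTop ℤ) ∧
      ∀ r, r ≠ 69 → r < 74 ∨ 84 < r → S' r = S r := by
  obtain ⟨hn, hpX, hpY, hpYF, hFw, hMw, hn3w⟩ := hG
  have hnn : n ≤ n * n := Nat.le_mul_self n
  have hwsp : wspNT n = 2 * (n * n) + 9 * (cubeRt n * cubeRt n) + 3 := rfl
  have hbigM : big q.M = 16 * q.M + 4 := rfl
  -- block 1: global indices and the activity flags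
  obtain ⟨st₁, hex₁, S₁, rfl, h74, h75, h80, hS₁⟩ : ∃ st₁, Exec w O (block arcTOps1) ⟨merge S H, qs⟩ st₁ 17 ∧
      ∃ S₁, st₁ = ⟨merge S₁ H, qs⟩ ∧ S₁ 74 = q.bi * q.L + iv ∧ S₁ 75 = q.bj * q.L + iu ∧
        S₁ 80 = (if (((((q.bi * q.L + iv < n ∧ q.bj * q.L + iu < n) ∧ ¬ iv < q.rlo) ∧ iv < q.rhi) ∧
            ¬ iu < q.clo) ∧ iu < q.chi) then 1 else 0) ∧
        ∀ r, r < 74 ∨ 80 < r → S₁ r = S r := by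
    refine Exec.block_of_fwd _ _ fun R hR => ?_
    unfold arcTOps1 at hR
    have htmp := execOps_cons_fwd hR; clear hR; obtain ⟨v1, hv1, hR⟩ := htmp
    simp -failIfUnchanged (disch := omega) only [Operand.write, Operand.read, merge_apply_of_lt,
        merge_apply_of_le, Function.update_self, Function.update_of_ne, update_merge_of_lt,
        update_merge_of_le, Nat.add_zero, BinOp.eval_mod, BinOp.eval_eq, BinOp.eval_band,
        BinOp.eval_shr, BinOp.eval_div, BinOp.eval_lt, BinOp.eval_add_of_lt, BinOp.eval_sub_of_le,
        BinOp.eval_mul_of_lt, h2, h25, h42, h43, h45, h46, h47, h48, h65, h67] at hv1 hR; subst hv1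
    have htmp := execOps_cons_fwd hR; clear hR; obtain ⟨v2, hv2, hR⟩ := htmp
    simp -failIfUnchanged (disch := omega) only [Operand.write, Operand.read, merge_apply_of_lt,
        merge_apply_of_le, Function.update_self, Function.update_of_ne, update_merge_of_lt,
        update_merge_of_le, Nat.add_zero, BinOp.eval_mod, BinOp.eval_eq, BinOp.eval_band,
        BinOp.eval_shr, BinOp.eval_div, BinOp.eval_lt, BinOp.eval_add_of_lt, BinOp.eval_sub_of_le,
        BinOp.eval_mul_of_lt, h2, h25, h42, h43, h45, h46, h47, h48, h65, h67] at hv2 hR; subst hv2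
    have htmp := execOps_cons_fwd hR; clear hR; obtain ⟨v3, hv3, hR⟩ := htmp
    simp -failIfUnchanged (disch := omega) only [Operand.write, Operand.read, merge_apply_of_lt,
        merge_apply_of_le, Function.update_self, Function.update_of_ne, update_merge_of_lt,
        update_merge_of_le, Nat.add_zero, BinOp.eval_mod, BinOp.eval_eq, BinOp.eval_band,
        BinOp.eval_shr, BinOp.eval_div, BinOp.eval_lt, BinOp.eval_add_of_lt, BinOp.eval_sub_of_le,
        BinOp.eval_mul_of_lt, h2, h25, h42, h43, h45, h46, h47, h48, h65, h67] at hv3 hR; subst hv3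
    have htmp := execOps_cons_fwd hR; clear hR; obtain ⟨v4, hv4, hR⟩ := htmp
    simp -failIfUnchanged (disch := omega) only [Operand.write, Operand.read, merge_apply_of_lt,
        merge_apply_of_le, Function.update_self, Function.update_of_ne, update_merge_of_lt,
        update_merge_of_le, Nat.add_zero, BinOp.eval_mod, BinOp.eval_eq, BinOp.eval_band,
        BinOp.eval_shr, BinOp.eval_div, BinOp.eval_lt, BinOp.eval_add_of_lt, BinOp.eval_sub_of_le,
        BinOp.eval_mul_of_lt, h2, h25, h42, h43, h45, h46, h47, h48, h65, h67] at hv4 hR; subst hv4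
    have htmp := execOps_cons_fwd hR; clear hR; obtain ⟨v5, hv5, hR⟩ := htmp
    simp -failIfUnchanged (disch := omega) only [Operand.write, Operand.read, merge_apply_of_lt,
        merge_apply_of_le, Function.update_self, Function.update_of_ne, update_merge_of_lt,
        update_merge_of_le, Nat.add_zero, BinOp.eval_mod, BinOp.eval_eq, BinOp.eval_band,
        BinOp.eval_shr, BinOp.eval_div, BinOp.eval_lt, BinOp.eval_add_of_lt, BinOp.eval_sub_of_le,
        BinOp.eval_mul_of_lt, h2, h25, h42, h43, h45, h46, h47, h48, h65, h67] at hv5 hR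
    have htmp := execOps_cons_fwd hR; clear hR; obtain ⟨v6, hv6, hR⟩ := htmp
    simp -failIfUnchanged (disch := omega) only [Operand.write, Operand.read, merge_apply_of_lt,
        merge_apply_of_le, Function.update_self, Function.update_of_ne, update_merge_of_lt,
        update_merge_of_le, Nat.add_zero, BinOp.eval_mod, BinOp.eval_eq, BinOp.eval_band,
        BinOp.eval_shr, BinOp.eval_div, BinOp.eval_lt, BinOp.eval_add_of_lt, BinOp.eval_sub_of_le,
        BinOp.eval_mul_of_lt, h2, h25, h42, h43, h45, h46, h47, h48, h65, h67] at hv6 hR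
    have hv56 : v5 * v6 ≤ 1 := mul_le_one_of_le_one (hv5 ▸ NegTriToAPSP.ite_le_one _) (hv6 ▸ NegTriToAPSP.ite_le_one _)
    have htmp := execOps_cons_fwd hR; clear hR; obtain ⟨v7, hv7, hR⟩ := htmp
    simp -failIfUnchanged (disch := omega) only [Operand.write, Operand.read, merge_apply_of_lt,
        merge_apply_of_le, Function.update_self, Function.update_of_ne, update_merge_of_lt,
        update_merge_of_le, Nat.add_zero, BinOp.eval_mod, BinOp.eval_eq, BinOp.eval_band,
        BinOp.eval_shr, BinOp.eval_div, BinOp.eval_lt, BinOp.eval_add_of_lt, BinOp.eval_sub_of_le,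
        BinOp.eval_mul_of_lt, h2, h25, h42, h43, h45, h46, h47, h48, h65, h67] at hv7 hR
    have htmp := execOps_cons_fwd hR; clear hR; obtain ⟨v8, hv8, hR⟩ := htmp
    simp -failIfUnchanged (disch := omega) only [Operand.write, Operand.read, merge_apply_of_lt,
        merge_apply_of_le, Function.update_self, Function.update_of_ne, update_merge_of_lt,
        update_merge_of_le, Nat.add_zero, BinOp.eval_mod, BinOp.eval_eq, BinOp.eval_band,
        BinOp.eval_shr, BinOp.eval_div, BinOp.eval_lt, BinOp.eval_add_of_lt, BinOp.eval_sub_of_le,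
        BinOp.eval_mul_of_lt, h2, h25, h42, h43, h45, h46, h47, h48, h65, h67] at hv8 hR
    have hv8' : v8 ≤ 1 := hv8 ▸ NegTriToAPSP.ite_le_one _
    have htmp := execOps_cons_fwd hR; clear hR; obtain ⟨v9, hv9, hR⟩ := htmp
    simp -failIfUnchanged (disch := omega) only [Operand.write, Operand.read, merge_apply_of_lt,
        merge_apply_of_le, Function.update_self, Function.update_of_ne, update_merge_of_lt,
        update_merge_of_le, Nat.add_zero, BinOp.eval_mod, BinOp.eval_eq, BinOp.eval_band,
        BinOp.eval_shr, BinOp.eval_div, BinOp.eval_lt, BinOp.eval_add_of_lt, BinOp.eval_sub_of_le,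
        BinOp.eval_mul_of_lt, h2, h25, h42, h43, h45, h46, h47, h48, h65, h67] at hv9 hR
    have hv79 : v7 * v9 ≤ 1 := mul_le_one_of_le_one (by rw [← hv7]; exact hv56) (by omega)
    have htmp := execOps_cons_fwd hR; clear hR; obtain ⟨v10, hv10, hR⟩ := htmp
    simp -failIfUnchanged (disch := omega) only [Operand.write, Operand.read, merge_apply_of_lt,
        merge_apply_of_le, Function.update_self, Function.update_of_ne, update_merge_of_lt,
        update_merge_of_le, Nat.add_zero, BinOp.eval_mod, BinOp.eval_eq, BinOp.eval_band,
        BinOp.eval_shr, BinOp.eval_div, BinOp.eval_lt, BinOp.eval_add_of_lt, BinOp.eval_sub_of_le,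
        BinOp.eval_mul_of_lt, h2, h25, h42, h43, h45, h46, h47, h48, h65, h67] at hv10 hR
    have htmp := execOps_cons_fwd hR; clear hR; obtain ⟨v11, hv11, hR⟩ := htmp
    simp -failIfUnchanged (disch := omega) only [Operand.write, Operand.read, merge_apply_of_lt,
        merge_apply_of_le, Function.update_self, Function.update_of_ne, update_merge_of_lt,
        update_merge_of_le, Nat.add_zero, BinOp.eval_mod, BinOp.eval_eq, BinOp.eval_band,
        BinOp.eval_shr, BinOp.eval_div, BinOp.eval_lt, BinOp.eval_add_of_lt, BinOp.eval_sub_of_le,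
        BinOp.eval_mul_of_lt, h2, h25, h42, h43, h45, h46, h47, h48, h65, h67] at hv11 hR
    have hv1011 : v10 * v11 ≤ 1 := mul_le_one_of_le_one (by rw [← hv10]; exact hv79) (hv11 ▸ NegTriToAPSP.ite_le_one _)
    have htmp := execOps_cons_fwd hR; clear hR; obtain ⟨v12, hv12, hR⟩ := htmp
    simp -failIfUnchanged (disch := omega) only [Operand.write, Operand.read, merge_apply_of_lt,
        merge_apply_of_le, Function.update_self, Function.update_of_ne, update_merge_of_lt,
        update_merge_of_le, Nat.add_zero, BinOp.eval_mod, BinOp.eval_eq, BinOp.eval_band,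
        BinOp.eval_shr, BinOp.eval_div, BinOp.eval_lt, BinOp.eval_add_of_lt, BinOp.eval_sub_of_le,
        BinOp.eval_mul_of_lt, h2, h25, h42, h43, h45, h46, h47, h48, h65, h67] at hv12 hR
    have htmp := execOps_cons_fwd hR; clear hR; obtain ⟨v13, hv13, hR⟩ := htmp
    simp -failIfUnchanged (disch := omega) only [Operand.write, Operand.read, merge_apply_of_lt,
        merge_apply_of_le, Function.update_self, Function.update_of_ne, update_merge_of_lt,
        update_merge_of_le, Nat.add_zero, BinOp.eval_mod, BinOp.eval_eq, BinOp.eval_band,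
        BinOp.eval_shr, BinOp.eval_div, BinOp.eval_lt, BinOp.eval_add_of_lt, BinOp.eval_sub_of_le,
        BinOp.eval_mul_of_lt, h2, h25, h42, h43, h45, h46, h47, h48, h65, h67] at hv13 hR
    have hv13' : v13 ≤ 1 := hv13 ▸ NegTriToAPSP.ite_le_one _
    have htmp := execOps_cons_fwd hR; clear hR; obtain ⟨v14, hv14, hR⟩ := htmp
    simp -failIfUnchanged (disch := omega) only [Operand.write, Operand.read, merge_apply_of_lt,
        merge_apply_of_le, Function.update_self, Function.update_of_ne, update_merge_of_lt,
        update_merge_of_le, Nat.add_zero, BinOp.eval_mod, BinOp.eval_eq, BinOp.eval_band,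
        BinOp.eval_shr, BinOp.eval_div, BinOp.eval_lt, BinOp.eval_add_of_lt, BinOp.eval_sub_of_le,
        BinOp.eval_mul_of_lt, h2, h25, h42, h43, h45, h46, h47, h48, h65, h67] at hv14 hR
    have hv1214 : v12 * v14 ≤ 1 := mul_le_one_of_le_one (by rw [← hv12]; exact hv1011) (by omega)
    have htmp := execOps_cons_fwd hR; clear hR; obtain ⟨v15, hv15, hR⟩ := htmp
    simp -failIfUnchanged (disch := omega) only [Operand.write, Operand.read, merge_apply_of_lt,
        merge_apply_of_le, Function.update_self, Function.update_of_ne, update_merge_of_lt,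
        update_merge_of_le, Nat.add_zero, BinOp.eval_mod, BinOp.eval_eq, BinOp.eval_band,
        BinOp.eval_shr, BinOp.eval_div, BinOp.eval_lt, BinOp.eval_add_of_lt, BinOp.eval_sub_of_le,
        BinOp.eval_mul_of_lt, h2, h25, h42, h43, h45, h46, h47, h48, h65, h67] at hv15 hR
    have htmp := execOps_cons_fwd hR; clear hR; obtain ⟨v16, hv16, hR⟩ := htmp
    simp -failIfUnchanged (disch := omega) only [Operand.write, Operand.read, merge_apply_of_lt,
        merge_apply_of_le, Function.update_self, Function.update_of_ne, update_merge_of_lt,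
        update_merge_of_le, Nat.add_zero, BinOp.eval_mod, BinOp.eval_eq, BinOp.eval_band,
        BinOp.eval_shr, BinOp.eval_div, BinOp.eval_lt, BinOp.eval_add_of_lt, BinOp.eval_sub_of_le,
        BinOp.eval_mul_of_lt, h2, h25, h42, h43, h45, h46, h47, h48, h65, h67] at hv16 hR
    have hv1516 : v15 * v16 ≤ 1 := mul_le_one_of_le_one (by rw [← hv15]; exact hv1214) (hv16 ▸ NegTriToAPSP.ite_le_one _)
    have htmp := execOps_cons_fwd hR; clear hR; obtain ⟨v17, hv17, hR⟩ := htmp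
    simp -failIfUnchanged (disch := omega) only [Operand.write, Operand.read, merge_apply_of_lt,
        merge_apply_of_le, Function.update_self, Function.update_of_ne, update_merge_of_lt,
        update_merge_of_le, Nat.add_zero, BinOp.eval_mod, BinOp.eval_eq, BinOp.eval_band,
        BinOp.eval_shr, BinOp.eval_div, BinOp.eval_lt, BinOp.eval_add_of_lt, BinOp.eval_sub_of_le,
        BinOp.eval_mul_of_lt, h2, h25, h42, h43, h45, h46, h47, h48, h65, h67] at hv17 hR
    simp only [execOps_nil] at hR; subst hR
    refine ⟨_, rfl, by simp, by simp, ?_, fun r hr => ?_⟩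
    · simp only [Function.update_self]
      rw [← hv17, ← hv16, ← hv15, ← hv14, ← hv13, ← hv12, ← hv11, ← hv10, ← hv9, ← hv8, ← hv7, ← hv6,
        ← hv5]
      simp only [ite_mul_ite, one_sub_ite]
    · rw [Function.update_of_ne (by omega), Function.update_of_ne (by omega),
        Function.update_of_ne (by omega), Function.update_of_ne (by omega),
        Function.update_of_ne (by omega), Function.update_of_ne (by omega),
        Function.update_of_ne (by omega), Function.update_of_ne (by omega),
        Function.update_of_ne (by omega), Function.update_of_ne (by omega),
        Function.update_of_ne (by omega), Function.update_of_ne (by omega),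
        Function.update_of_ne (by omega), Function.update_of_ne (by omega),
        Function.update_of_ne (by omega), Function.update_of_ne (by omega),
        Function.update_of_ne (by omega)]
  have h2₁ : S₁ 2 = n := (hS₁ 2 (by omega)).trans h2
  have h21₁ : S₁ 21 = 2 * q.M := (hS₁ 21 (by omega)).trans h21
  have h24₁ : S₁ 24 = q.pw := (hS₁ 24 (by omega)).trans h24
  have h31₁ : S₁ 31 = F := (hS₁ 31 (by omega)).trans h31
  have h32₁ : S₁ 32 = F + n * n := (hS₁ 32 (by omega)).trans h32
  have h69₁ : S₁ 69 = 2 * big q.M + 1 := (hS₁ 69 (by omega)).trans h69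
  set idx := (q.bi * q.L + iv) * n + (q.bj * q.L + iu) with hidx_def
  by_cases hcc : ((((q.bi * q.L + iv < n ∧ q.bj * q.L + iu < n) ∧ ¬ iv < q.rlo) ∧ iv < q.rhi) ∧
      ¬ iu < q.clo) ∧ iu < q.chi
  · -- geometrically active: the found test
    have h80' : (Operand.dir 80).read (merge S₁ H) ≠ 0 := by
      rw [Operand.read_dir_merge (by norm_num), h80, if_pos hcc]; exact one_ne_zero
    have hidx : idx < n * n := NegTriToAPSP.mul_add_lt_mul hcc.1.1.1.1.1 hcc.1.1.1.1.2
    have hfd : H (F + n * n + ((q.bi * q.L + iv) * n + (q.bj * q.L + iu))) = q.fd idx := hD.fd idx hidx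
    have hlo : H (F + idx) = q.lo idx := hD.lo idx hidx
    have hlow : q.lo idx + q.pw ≤ 8 * q.M + 2 := hok.hlo idx hidx
    have hfdw : q.fd idx < 2 ^ w := by have := hfdb idx hidx; omega
    have hlow' : q.lo idx + q.pw < 2 ^ w := by omega
    -- block 2: the found test
    obtain ⟨st₂, hex₂, S₂, rfl, h81, h82, hS₂⟩ : ∃ st₂, Exec w O (block arcTOps2) ⟨merge S₁ H, qs⟩ st₂ 5 ∧
        ∃ S₂, st₂ = ⟨merge S₂ H, qs⟩ ∧ S₂ 81 = idx ∧ S₂ 82 = (if q.fd idx = q.pw then 1 else 0) ∧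
          ∀ r, r < 78 ∨ 82 < r → r ≠ 81 → S₂ r = S₁ r := by
      refine Exec.block_of_fwd _ _ fun R hR => ?_
      unfold arcTOps2 at hR
      have htmp := execOps_cons_fwd hR; clear hR; obtain ⟨v1, hv1, hR⟩ := htmp
      simp -failIfUnchanged (disch := omega) only [Operand.write, Operand.read, merge_apply_of_lt,
          merge_apply_of_le, Function.update_self, Function.update_of_ne, update_merge_of_lt,
          update_merge_of_le, Nat.add_zero, BinOp.eval_mod, BinOp.eval_eq, BinOp.eval_band,
          BinOp.eval_shr, BinOp.eval_div, BinOp.eval_lt, BinOp.eval_add_of_lt, BinOp.eval_sub_of_le,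
          BinOp.eval_mul_of_lt, h2₁, h24₁, h32₁, h74, h75, hfd] at hv1 hR; subst hv1
      have htmp := execOps_cons_fwd hR; clear hR; obtain ⟨v2, hv2, hR⟩ := htmp
      simp -failIfUnchanged (disch := omega) only [Operand.write, Operand.read, merge_apply_of_lt,
          merge_apply_of_le, Function.update_self, Function.update_of_ne, update_merge_of_lt,
          update_merge_of_le, Nat.add_zero, BinOp.eval_mod, BinOp.eval_eq, BinOp.eval_band,
          BinOp.eval_shr, BinOp.eval_div, BinOp.eval_lt, BinOp.eval_add_of_lt, BinOp.eval_sub_of_le,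
          BinOp.eval_mul_of_lt, h2₁, h24₁, h32₁, h74, h75, hfd] at hv2 hR; subst hv2
      have htmp := execOps_cons_fwd hR; clear hR; obtain ⟨v3, hv3, hR⟩ := htmp
      simp -failIfUnchanged (disch := omega) only [Operand.write, Operand.read, merge_apply_of_lt,
          merge_apply_of_le, Function.update_self, Function.update_of_ne, update_merge_of_lt,
          update_merge_of_le, Nat.add_zero, BinOp.eval_mod, BinOp.eval_eq, BinOp.eval_band,
          BinOp.eval_shr, BinOp.eval_div, BinOp.eval_lt, BinOp.eval_add_of_lt, BinOp.eval_sub_of_le,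
          BinOp.eval_mul_of_lt, h2₁, h24₁, h32₁, h74, h75, hfd] at hv3 hR; subst hv3
      have htmp := execOps_cons_fwd hR; clear hR; obtain ⟨v4, hv4, hR⟩ := htmp
      simp -failIfUnchanged (disch := omega) only [Operand.write, Operand.read, merge_apply_of_lt,
          merge_apply_of_le, Function.update_self, Function.update_of_ne, update_merge_of_lt,
          update_merge_of_le, Nat.add_zero, BinOp.eval_mod, BinOp.eval_eq, BinOp.eval_band,
          BinOp.eval_shr, BinOp.eval_div, BinOp.eval_lt, BinOp.eval_add_of_lt, BinOp.eval_sub_of_le,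
          BinOp.eval_mul_of_lt, h2₁, h24₁, h32₁, h74, h75, hfd] at hv4 hR; subst hv4
      have htmp := execOps_cons_fwd hR; clear hR; obtain ⟨v5, hv5, hR⟩ := htmp
      simp -failIfUnchanged (disch := omega) only [Operand.write, Operand.read, merge_apply_of_lt,
          merge_apply_of_le, Function.update_self, Function.update_of_ne, update_merge_of_lt,
          update_merge_of_le, Nat.add_zero, BinOp.eval_mod, BinOp.eval_eq, BinOp.eval_band,
          BinOp.eval_shr, BinOp.eval_div, BinOp.eval_lt, BinOp.eval_add_of_lt, BinOp.eval_sub_of_le,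
          BinOp.eval_mul_of_lt, h2₁, h24₁, h32₁, h74, h75, hfd] at hv5 hR
      simp only [execOps_nil] at hR; subst hR
      refine ⟨_, rfl, by simp [hidx_def], ?_, fun r hr hr' => ?_⟩
      · simp only [Function.update_self]; rw [← hv5]
      · rw [Function.update_of_ne (by omega), Function.update_of_ne (by omega),
          Function.update_of_ne (by omega), Function.update_of_ne (by omega),
          Function.update_of_ne (by omega)]
    have h2₂ : S₂ 2 = n := (hS₂ 2 (by omega) (by omega)).trans h2₁
    have h21₂ : S₂ 21 = 2 * q.M := (hS₂ 21 (by omega) (by omega)).trans h21₁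
    have h24₂ : S₂ 24 = q.pw := (hS₂ 24 (by omega) (by omega)).trans h24₁
    have h31₂ : S₂ 31 = F := (hS₂ 31 (by omega) (by omega)).trans h31₁
    have h69₂ : S₂ 69 = 2 * big q.M + 1 := (hS₂ 69 (by omega) (by omega)).trans h69₁
    by_cases hfound : q.fd idx = q.pw
    · -- already found in this round: inactive, keep the non-edge code
      have h82' : (Operand.dir 82).read (merge S₂ H) ≠ 0 := by
        rw [Operand.read_dir_merge (by norm_num), h82, if_pos hfound]; exact one_ne_zero
      refine ⟨S₂, (hex₁.execLE.seq (ExecLE.ifz_ne h80' (hex₂.execLE.seq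
        (ExecLE.ifz_ne h82' (ExecLE.skip _ 0))))).mono (by norm_num), ?_, fun r hr hr' => ?_⟩
      · rw [h69₂, encodeWithTopInt_tarc, if_neg]
        rintro ⟨-, -, -, -, -, -, h7⟩
        exact h7 hfound
      · rw [hS₂ r (by omega) (by omega), hS₁ r (by omega)]
    · -- active: the threshold and the sign of the weight
      have h82' : (Operand.dir 82).read (merge S₂ H) = 0 := by
        rw [Operand.read_dir_merge (by norm_num), h82, if_neg hfound]
      have hact : q.Active iu iv := ⟨hcc.1.1.1.1.1, hcc.1.1.1.1.2, Nat.not_lt.1 hcc.1.1.1.2, hcc.1.1.2,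
        Nat.not_lt.1 hcc.1.2, hcc.2, hfound⟩
      obtain ⟨st₃, hex₃, S₃, rfl, h83, h84, hS₃⟩ : ∃ st₃, Exec w O (block arcTOps3) ⟨merge S₂ H, qs⟩ st₃ 4 ∧
          ∃ S₃, st₃ = ⟨merge S₃ H, qs⟩ ∧ S₃ 83 = q.lo idx + q.pw ∧
            S₃ 84 = (if 2 * q.M < q.lo idx + q.pw then 1 else 0) ∧
            ∀ r, r < 78 ∨ 84 < r → S₃ r = S₂ r := by
        refine Exec.block_of_fwd _ _ fun R hR => ?_
        unfold arcTOps3 at hR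
        have htmp := execOps_cons_fwd hR; clear hR; obtain ⟨v1, hv1, hR⟩ := htmp
        simp -failIfUnchanged (disch := omega) only [Operand.write, Operand.read, merge_apply_of_lt,
            merge_apply_of_le, Function.update_self, Function.update_of_ne, update_merge_of_lt,
            update_merge_of_le, Nat.add_zero, BinOp.eval_mod, BinOp.eval_eq, BinOp.eval_band,
            BinOp.eval_shr, BinOp.eval_div, BinOp.eval_lt, BinOp.eval_add_of_lt, BinOp.eval_sub_of_le,
            BinOp.eval_mul_of_lt, h24₂, h21₂, h31₂, h81, hlo] at hv1 hR; subst hv1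
        have htmp := execOps_cons_fwd hR; clear hR; obtain ⟨v2, hv2, hR⟩ := htmp
        simp -failIfUnchanged (disch := omega) only [Operand.write, Operand.read, merge_apply_of_lt,
            merge_apply_of_le, Function.update_self, Function.update_of_ne, update_merge_of_lt,
            update_merge_of_le, Nat.add_zero, BinOp.eval_mod, BinOp.eval_eq, BinOp.eval_band,
            BinOp.eval_shr, BinOp.eval_div, BinOp.eval_lt, BinOp.eval_add_of_lt, BinOp.eval_sub_of_le,
            BinOp.eval_mul_of_lt, h24₂, h21₂, h31₂, h81, hlo] at hv2 hR; subst hv2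
        have htmp := execOps_cons_fwd hR; clear hR; obtain ⟨v3, hv3, hR⟩ := htmp
        simp -failIfUnchanged (disch := omega) only [Operand.write, Operand.read, merge_apply_of_lt,
            merge_apply_of_le, Function.update_self, Function.update_of_ne, update_merge_of_lt,
            update_merge_of_le, Nat.add_zero, BinOp.eval_mod, BinOp.eval_eq, BinOp.eval_band,
            BinOp.eval_shr, BinOp.eval_div, BinOp.eval_lt, BinOp.eval_add_of_lt, BinOp.eval_sub_of_le,
            BinOp.eval_mul_of_lt, h24₂, h21₂, h31₂, h81, hlo] at hv3 hR; subst hv3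
        have htmp := execOps_cons_fwd hR; clear hR; obtain ⟨v4, hv4, hR⟩ := htmp
        simp -failIfUnchanged (disch := omega) only [Operand.write, Operand.read, merge_apply_of_lt,
            merge_apply_of_le, Function.update_self, Function.update_of_ne, update_merge_of_lt,
            update_merge_of_le, Nat.add_zero, BinOp.eval_mod, BinOp.eval_eq, BinOp.eval_band,
            BinOp.eval_shr, BinOp.eval_div, BinOp.eval_lt, BinOp.eval_add_of_lt, BinOp.eval_sub_of_le,
            BinOp.eval_mul_of_lt, h24₂, h21₂, h31₂, h81, hlo] at hv4 hR
        simp only [execOps_nil] at hR; subst hR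
        refine ⟨_, rfl, by simp, ?_, fun r hr => ?_⟩
        · simp only [Function.update_self]; rw [← hv4]
        · rw [Function.update_of_ne (by omega), Function.update_of_ne (by omega),
            Function.update_of_ne (by omega), Function.update_of_ne (by omega)]
      have h21₃ : S₃ 21 = 2 * q.M := (hS₃ 21 (by omega)).trans h21₂
      by_cases hneg : 2 * q.M < q.lo idx + q.pw
      · -- negative weight `2M - s`: code `2 (s - 2M)`
        have h84' : (Operand.dir 84).read (merge S₃ H) ≠ 0 := by
          rw [Operand.read_dir_merge (by norm_num), h84, if_pos hneg]; exact one_ne_zero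
        obtain ⟨st₄, hex₄, S₄, rfl, h69₄, hS₄⟩ : ∃ st₄, Exec w O (block arcTNeg) ⟨merge S₃ H, qs⟩ st₄ 2 ∧
            ∃ S₄, st₄ = ⟨merge S₄ H, qs⟩ ∧ S₄ 69 = 2 * (q.lo idx + q.pw - 2 * q.M) ∧
              ∀ r, r ≠ 69 → S₄ r = S₃ r := by
          refine Exec.block_of_fwd _ _ fun R hR => ?_
          unfold arcTNeg at hR
          have htmp := execOps_cons_fwd hR; clear hR; obtain ⟨v1, hv1, hR⟩ := htmp
          simp -failIfUnchanged (disch := omega) only [Operand.write, Operand.read, merge_apply_of_lt,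
              merge_apply_of_le, Function.update_self, Function.update_of_ne, update_merge_of_lt,
              update_merge_of_le, Nat.add_zero, BinOp.eval_mod, BinOp.eval_eq, BinOp.eval_band,
              BinOp.eval_shr, BinOp.eval_div, BinOp.eval_lt, BinOp.eval_add_of_lt, BinOp.eval_sub_of_le,
              BinOp.eval_mul_of_lt, h21₃, h83] at hv1 hR; subst hv1
          have htmp := execOps_cons_fwd hR; clear hR; obtain ⟨v2, hv2, hR⟩ := htmp
          simp -failIfUnchanged (disch := omega) only [Operand.write, Operand.read, merge_apply_of_lt,
              merge_apply_of_le, Function.update_self, Function.update_of_ne, update_merge_of_lt,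
              update_merge_of_le, Nat.add_zero, BinOp.eval_mod, BinOp.eval_eq, BinOp.eval_band,
              BinOp.eval_shr, BinOp.eval_div, BinOp.eval_lt, BinOp.eval_add_of_lt, BinOp.eval_sub_of_le,
              BinOp.eval_mul_of_lt, h21₃, h83] at hv2 hR; subst hv2
          simp only [execOps_nil] at hR; subst hR
          refine ⟨_, rfl, ?_, fun r hr => ?_⟩
          · simp only [Function.update_self]; omega
          · rw [Function.update_of_ne hr, Function.update_of_ne hr]
        refine ⟨S₄, (hex₁.execLE.seq (ExecLE.ifz_ne h80' (hex₂.execLE.seq (ExecLE.ifz_zero h82'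
          (hex₃.execLE.seq (ExecLE.ifz_ne h84' hex₄.execLE)))))).mono (by norm_num), ?_, fun r hr hr' => ?_⟩
        · rw [h69₄, encodeWithTopInt_tarc, if_pos hact, if_pos hneg]
        · rw [hS₄ r hr, hS₃ r (by omega), hS₂ r (by omega) (by omega), hS₁ r (by omega)]
      · -- nonnegative weight: code `2 (2M - s) + 1`
        have h84' : (Operand.dir 84).read (merge S₃ H) = 0 := by
          rw [Operand.read_dir_merge (by norm_num), h84, if_neg hneg]
        obtain ⟨st₄, hex₄, S₄, rfl, h69₄, hS₄⟩ : ∃ st₄, Exec w O (block arcTPos) ⟨merge S₃ H, qs⟩ st₄ 3 ∧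
            ∃ S₄, st₄ = ⟨merge S₄ H, qs⟩ ∧ S₄ 69 = 2 * (2 * q.M - (q.lo idx + q.pw)) + 1 ∧
              ∀ r, r ≠ 69 → S₄ r = S₃ r := by
          refine Exec.block_of_fwd _ _ fun R hR => ?_
          unfold arcTPos at hR
          have htmp := execOps_cons_fwd hR; clear hR; obtain ⟨v1, hv1, hR⟩ := htmp
          simp -failIfUnchanged (disch := omega) only [Operand.write, Operand.read, merge_apply_of_lt,
              merge_apply_of_le, Function.update_self, Function.update_of_ne, update_merge_of_lt,
              update_merge_of_le, Nat.add_zero, BinOp.eval_mod, BinOp.eval_eq, BinOp.eval_band,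
              BinOp.eval_shr, BinOp.eval_div, BinOp.eval_lt, BinOp.eval_add_of_lt, BinOp.eval_sub_of_le,
              BinOp.eval_mul_of_lt, h21₃, h83] at hv1 hR; subst hv1
          have htmp := execOps_cons_fwd hR; clear hR; obtain ⟨v2, hv2, hR⟩ := htmp
          simp -failIfUnchanged (disch := omega) only [Operand.write, Operand.read, merge_apply_of_lt,
              merge_apply_of_le, Function.update_self, Function.update_of_ne, update_merge_of_lt,
              update_merge_of_le, Nat.add_zero, BinOp.eval_mod, BinOp.eval_eq, BinOp.eval_band,
              BinOp.eval_shr, BinOp.eval_div, BinOp.eval_lt, BinOp.eval_add_of_lt, BinOp.eval_sub_of_le,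
              BinOp.eval_mul_of_lt, h21₃, h83] at hv2 hR; subst hv2
          have htmp := execOps_cons_fwd hR; clear hR; obtain ⟨v3, hv3, hR⟩ := htmp
          simp -failIfUnchanged (disch := omega) only [Operand.write, Operand.read, merge_apply_of_lt,
              merge_apply_of_le, Function.update_self, Function.update_of_ne, update_merge_of_lt,
              update_merge_of_le, Nat.add_zero, BinOp.eval_mod, BinOp.eval_eq, BinOp.eval_band,
              BinOp.eval_shr, BinOp.eval_div, BinOp.eval_lt, BinOp.eval_add_of_lt, BinOp.eval_sub_of_le,
              BinOp.eval_mul_of_lt, h21₃, h83] at hv3 hR; subst hv3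
          simp only [execOps_nil] at hR; subst hR
          refine ⟨_, rfl, ?_, fun r hr => ?_⟩
          · simp only [Function.update_self]; omega
          · rw [Function.update_of_ne hr, Function.update_of_ne hr, Function.update_of_ne hr]
        refine ⟨S₄, (hex₁.execLE.seq (ExecLE.ifz_ne h80' (hex₂.execLE.seq (ExecLE.ifz_zero h82'
          (hex₃.execLE.seq (ExecLE.ifz_zero h84' hex₄.execLE)))))).mono (by norm_num), ?_, fun r hr hr' => ?_⟩
        · rw [h69₄, encodeWithTopInt_tarc, if_pos hact, if_neg hneg]
        · rw [hS₄ r hr, hS₃ r (by omega), hS₂ r (by omega) (by omega), hS₁ r (by omega)]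
  · -- inactive: keep the non-edge code
    have h80' : (Operand.dir 80).read (merge S₁ H) = 0 := by
      rw [Operand.read_dir_merge (by norm_num), h80, if_neg hcc]
    refine ⟨S₁, (hex₁.execLE.seq (ExecLE.ifz_zero h80' (ExecLE.skip _ 0))).mono (by norm_num), ?_,
      fun r hr hr' => hS₁ r (by omega)⟩
    rw [h69₁, encodeWithTopInt_tarc, if_neg]
    rintro ⟨h1, h2, h3, h4, h5, h6, -⟩
    exact hcc ⟨⟨⟨⟨⟨h1, h2⟩, Nat.not_lt.2 h3⟩, h4⟩, Nat.not_lt.2 h5⟩, h6⟩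

end Arcs

section Cell

variable {w : ℕ} {O : List ℕ → List ℕ} {F pX pY : ℕ} {c' : ℕ} {q : QData n} {H₀ H : ℕ → ℕ}

/-- The operand `X` is still in place during the rounds. [folklore] -/
theorem DataQ.matAt_X (hD : DataQ q F H₀ H) (hG : Geo n w F pX pY q.M) (hX0 : MatAt H₀ pX q.X) :
    MatAt H pX q.X := fun i j => by
  have := NegTriToAPSP.mul_add_lt_mul i.isLt j.isLt
  rw [hD.below _ (by have := hG.hpY; have := hG.hpYF; omega)]; exact hX0 i j

/-- The operand `Y` is still in place during the rounds. [folklore] -/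
theorem DataQ.matAt_Y (hD : DataQ q F H₀ H) (hG : Geo n w F pX pY q.M) (hY0 : MatAt H₀ pY q.Y) :
    MatAt H pY q.Y := fun i j => by
  have := NegTriToAPSP.mul_add_lt_mul i.isLt j.isLt
  rw [hD.below _ (by have := hG.hpYF; omega)]; exact hY0 i j

set_option linter.unusedSimpArgs false in
/-- **Decoding the cell number.** [folklore] -/
theorem decodeCell_spec {S H : ℕ → ℕ} {qs : List (List ℕ)} {m L M : ℕ} (hL : 0 < L) (hm : m < 9 * (L * L))
    (hMw : 2 * big M + 1 < 2 ^ w) (h23 : S 23 = 2 * big M + 1) (h25 : S 25 = L) (h26 : S 26 = 3 * L)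
    (h60 : S 60 = m) :
    ∃ S₁, Exec w O (block decodeOps) ⟨merge S H, qs⟩ ⟨merge S₁ H, qs⟩ 9 ∧
      S₁ 65 = m / (3 * L) % L ∧ S₁ 67 = m % (3 * L) % L ∧
      S₁ 68 = 3 * (m / (3 * L) / L) + m % (3 * L) / L ∧ S₁ 69 = 2 * big M + 1 ∧
      ∀ r, r < 62 ∨ 69 < r → S₁ r = S r := by
  have hbigM : big M = 16 * M + 4 := rfl
  have h3L : 0 < 3 * L := by omega
  have hu : m / (3 * L) < 3 * L := Nat.div_lt_of_lt_mul (by nlinarith)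
  have hpu : m / (3 * L) / L < 3 := Nat.div_lt_of_lt_mul (by linarith)
  have hpv : m % (3 * L) / L < 3 := Nat.div_lt_of_lt_mul (by linarith [Nat.mod_lt m h3L])
  obtain ⟨st₁, hex₁, S₁, rfl, h⟩ : ∃ st₁, Exec w O (block decodeOps) ⟨merge S H, qs⟩ st₁ 9 ∧
      ∃ S₁, st₁ = ⟨merge S₁ H, qs⟩ ∧ (S₁ 65 = m / (3 * L) % L ∧ S₁ 67 = m % (3 * L) % L ∧
      S₁ 68 = 3 * (m / (3 * L) / L) + m % (3 * L) / L ∧ S₁ 69 = 2 * big M + 1 ∧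
      ∀ r, r < 62 ∨ 69 < r → S₁ r = S r) := by
    refine Exec.block_of_fwd _ _ fun R hR => ?_
    unfold decodeOps at hR
    have htmp := execOps_cons_fwd hR; clear hR; obtain ⟨v1, hv1, hR⟩ := htmp
    simp -failIfUnchanged (disch := omega) only [Operand.write, Operand.read, merge_apply_of_lt,
        merge_apply_of_le, Function.update_self, Function.update_of_ne, update_merge_of_lt,
        update_merge_of_le, Nat.add_zero, BinOp.eval_mod, BinOp.eval_eq, BinOp.eval_band,
        BinOp.eval_shr, BinOp.eval_div, BinOp.eval_lt, BinOp.eval_add_of_lt, BinOp.eval_sub_of_le,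
        BinOp.eval_mul_of_lt, h23, h25, h26, h60] at hv1 hR; subst hv1
    have htmp := execOps_cons_fwd hR; clear hR; obtain ⟨v2, hv2, hR⟩ := htmp
    simp -failIfUnchanged (disch := omega) only [Operand.write, Operand.read, merge_apply_of_lt,
        merge_apply_of_le, Function.update_self, Function.update_of_ne, update_merge_of_lt,
        update_merge_of_le, Nat.add_zero, BinOp.eval_mod, BinOp.eval_eq, BinOp.eval_band,
        BinOp.eval_shr, BinOp.eval_div, BinOp.eval_lt, BinOp.eval_add_of_lt, BinOp.eval_sub_of_le,
        BinOp.eval_mul_of_lt, h23, h25, h26, h60] at hv2 hR; subst hv2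
    have htmp := execOps_cons_fwd hR; clear hR; obtain ⟨v3, hv3, hR⟩ := htmp
    simp -failIfUnchanged (disch := omega) only [Operand.write, Operand.read, merge_apply_of_lt,
        merge_apply_of_le, Function.update_self, Function.update_of_ne, update_merge_of_lt,
        update_merge_of_le, Nat.add_zero, BinOp.eval_mod, BinOp.eval_eq, BinOp.eval_band,
        BinOp.eval_shr, BinOp.eval_div, BinOp.eval_lt, BinOp.eval_add_of_lt, BinOp.eval_sub_of_le,
        BinOp.eval_mul_of_lt, h23, h25, h26, h60] at hv3 hR; subst hv3
    have htmp := execOps_cons_fwd hR; clear hR; obtain ⟨v4, hv4, hR⟩ := htmp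
    simp -failIfUnchanged (disch := omega) only [Operand.write, Operand.read, merge_apply_of_lt,
        merge_apply_of_le, Function.update_self, Function.update_of_ne, update_merge_of_lt,
        update_merge_of_le, Nat.add_zero, BinOp.eval_mod, BinOp.eval_eq, BinOp.eval_band,
        BinOp.eval_shr, BinOp.eval_div, BinOp.eval_lt, BinOp.eval_add_of_lt, BinOp.eval_sub_of_le,
        BinOp.eval_mul_of_lt, h23, h25, h26, h60] at hv4 hR; subst hv4
    have htmp := execOps_cons_fwd hR; clear hR; obtain ⟨v5, hv5, hR⟩ := htmp
    simp -failIfUnchanged (disch := omega) only [Operand.write, Operand.read, merge_apply_of_lt,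
        merge_apply_of_le, Function.update_self, Function.update_of_ne, update_merge_of_lt,
        update_merge_of_le, Nat.add_zero, BinOp.eval_mod, BinOp.eval_eq, BinOp.eval_band,
        BinOp.eval_shr, BinOp.eval_div, BinOp.eval_lt, BinOp.eval_add_of_lt, BinOp.eval_sub_of_le,
        BinOp.eval_mul_of_lt, h23, h25, h26, h60] at hv5 hR; subst hv5
    have htmp := execOps_cons_fwd hR; clear hR; obtain ⟨v6, hv6, hR⟩ := htmp
    simp -failIfUnchanged (disch := omega) only [Operand.write, Operand.read, merge_apply_of_lt,
        merge_apply_of_le, Function.update_self, Function.update_of_ne, update_merge_of_lt,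
        update_merge_of_le, Nat.add_zero, BinOp.eval_mod, BinOp.eval_eq, BinOp.eval_band,
        BinOp.eval_shr, BinOp.eval_div, BinOp.eval_lt, BinOp.eval_add_of_lt, BinOp.eval_sub_of_le,
        BinOp.eval_mul_of_lt, h23, h25, h26, h60] at hv6 hR; subst hv6
    have htmp := execOps_cons_fwd hR; clear hR; obtain ⟨v7, hv7, hR⟩ := htmp
    simp -failIfUnchanged (disch := omega) only [Operand.write, Operand.read, merge_apply_of_lt,
        merge_apply_of_le, Function.update_self, Function.update_of_ne, update_merge_of_lt,
        update_merge_of_le, Nat.add_zero, BinOp.eval_mod, BinOp.eval_eq, BinOp.eval_band,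
        BinOp.eval_shr, BinOp.eval_div, BinOp.eval_lt, BinOp.eval_add_of_lt, BinOp.eval_sub_of_le,
        BinOp.eval_mul_of_lt, h23, h25, h26, h60] at hv7 hR; subst hv7
    have htmp := execOps_cons_fwd hR; clear hR; obtain ⟨v8, hv8, hR⟩ := htmp
    simp -failIfUnchanged (disch := omega) only [Operand.write, Operand.read, merge_apply_of_lt,
        merge_apply_of_le, Function.update_self, Function.update_of_ne, update_merge_of_lt,
        update_merge_of_le, Nat.add_zero, BinOp.eval_mod, BinOp.eval_eq, BinOp.eval_band,
        BinOp.eval_shr, BinOp.eval_div, BinOp.eval_lt, BinOp.eval_add_of_lt, BinOp.eval_sub_of_le,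
        BinOp.eval_mul_of_lt, h23, h25, h26, h60] at hv8 hR; subst hv8
    have htmp := execOps_cons_fwd hR; clear hR; obtain ⟨v9, hv9, hR⟩ := htmp
    simp -failIfUnchanged (disch := omega) only [Operand.write, Operand.read, merge_apply_of_lt,
        merge_apply_of_le, Function.update_self, Function.update_of_ne, update_merge_of_lt,
        update_merge_of_le, Nat.add_zero, BinOp.eval_mod, BinOp.eval_eq, BinOp.eval_band,
        BinOp.eval_shr, BinOp.eval_div, BinOp.eval_lt, BinOp.eval_add_of_lt, BinOp.eval_sub_of_le,
        BinOp.eval_mul_of_lt, h23, h25, h26, h60] at hv9 hR; subst hv9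
    simp only [execOps_nil] at hR; subst hR
    refine ⟨_, rfl, by simp, by simp, ?_, by simp, fun r hr => ?_⟩
    · simp only [Function.update_self, Function.update_of_ne, ne_eq, Nat.reduceEqDiff, not_false_eq_true]
      omega
    · rw [Function.update_of_ne (by omega), Function.update_of_ne (by omega),
        Function.update_of_ne (by omega), Function.update_of_ne (by omega),
        Function.update_of_ne (by omega), Function.update_of_ne (by omega),
        Function.update_of_ne (by omega), Function.update_of_ne (by omega),
        Function.update_of_ne (by omega)]
  exact ⟨S₁, hex₁, h⟩

set_option linter.unusedSimpArgs false in
/-- A selector test `r70 := [sel = k]`. [folklore] -/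
theorem guard_spec {S H : ℕ → ℕ} {qs : List (List ℕ)} (k : ℕ) {sel : ℕ} (h68 : S 68 = sel) :
    ∃ S₁, Exec w O (block [(.eq, .dir 70, .dir 68, .imm k)]) ⟨merge S H, qs⟩ ⟨merge S₁ H, qs⟩ 1 ∧
      S₁ 70 = (if sel = k then 1 else 0) ∧ ∀ r, r ≠ 70 → S₁ r = S r := by
  obtain ⟨st₁, hex₁, S₁, rfl, h⟩ : ∃ st₁, Exec w O (block [(.eq, .dir 70, .dir 68, .imm k)]) ⟨merge S H, qs⟩ st₁ 1 ∧
      ∃ S₁, st₁ = ⟨merge S₁ H, qs⟩ ∧ (S₁ 70 = (if sel = k then 1 else 0) ∧ ∀ r, r ≠ 70 → S₁ r = S r) := by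
    refine Exec.block_of_fwd _ _ fun R hR => ?_
    have htmp := execOps_cons_fwd hR; clear hR; obtain ⟨v1, hv1, hR⟩ := htmp
    simp -failIfUnchanged (disch := omega) only [Operand.write, Operand.read, merge_apply_of_lt,
        merge_apply_of_le, Function.update_self, Function.update_of_ne, update_merge_of_lt,
        update_merge_of_le, Nat.add_zero, BinOp.eval_mod, BinOp.eval_eq, BinOp.eval_band,
        BinOp.eval_shr, BinOp.eval_div, BinOp.eval_lt, BinOp.eval_add_of_lt, BinOp.eval_sub_of_le,
        BinOp.eval_mul_of_lt, h68] at hv1 hR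
    simp only [execOps_nil] at hR; subst hR
    exact ⟨_, rfl, by simp only [Function.update_self]; rw [← hv1], fun r hr => by rw [Function.update_of_ne hr]⟩
  exact ⟨S₁, hex₁, h⟩

set_option linter.unusedSimpArgs false in
/-- Selecting the operand blocks of an arc (`selXOps` / `selYOps`). [folklore] -/
theorem sel_spec {S H : ℕ → ℕ} {qs : List (List ℕ)} {a b d va vb vd : ℕ} (ha : a < 100) (hb : b < 100)
    (hd : d < 100) (hva : S a = va) (hvb : S b = vb) (hvd : S d = vd) (hw : va < 2 ^ w) (hw' : vb < 2 ^ w)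
    (hw'' : vd < 2 ^ w) (hb7 : b < 71 ∨ 73 < b) (hd7 : d < 71 ∨ 73 < d) :
    ∃ S₁, Exec w O (block [(.add, .dir 71, .dir a, .imm 0), (.add, .dir 72, .dir b, .imm 0),
        (.add, .dir 73, .dir d, .imm 0)]) ⟨merge S H, qs⟩ ⟨merge S₁ H, qs⟩ 3 ∧
      S₁ 71 = va ∧ S₁ 72 = vb ∧ S₁ 73 = vd ∧ ∀ r, r < 71 ∨ 73 < r → S₁ r = S r := by
  obtain ⟨st₁, hex₁, S₁, rfl, h⟩ : ∃ st₁, Exec w O (block [(.add, .dir 71, .dir a, .imm 0),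
      (.add, .dir 72, .dir b, .imm 0), (.add, .dir 73, .dir d, .imm 0)]) ⟨merge S H, qs⟩ st₁ 3 ∧
      ∃ S₁, st₁ = ⟨merge S₁ H, qs⟩ ∧ (S₁ 71 = va ∧ S₁ 72 = vb ∧ S₁ 73 = vd ∧
        ∀ r, r < 71 ∨ 73 < r → S₁ r = S r) := by
    refine Exec.block_of_fwd _ _ fun R hR => ?_
    have htmp := execOps_cons_fwd hR; clear hR; obtain ⟨v1, hv1, hR⟩ := htmp
    simp -failIfUnchanged (disch := omega) only [Operand.write, Operand.read, merge_apply_of_lt,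
        merge_apply_of_le, Function.update_self, Function.update_of_ne, update_merge_of_lt,
        update_merge_of_le, Nat.add_zero, BinOp.eval_mod, BinOp.eval_eq, BinOp.eval_band,
        BinOp.eval_shr, BinOp.eval_div, BinOp.eval_lt, BinOp.eval_add_of_lt, BinOp.eval_sub_of_le,
        BinOp.eval_mul_of_lt, hva, hvb, hvd, merge_apply_of_lt ha, merge_apply_of_lt hb, merge_apply_of_lt hd] at hv1 hR; subst hv1
    have htmp := execOps_cons_fwd hR; clear hR; obtain ⟨v2, hv2, hR⟩ := htmp
    simp -failIfUnchanged (disch := omega) only [Operand.write, Operand.read, merge_apply_of_lt,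
        merge_apply_of_le, Function.update_self, Function.update_of_ne, update_merge_of_lt,
        update_merge_of_le, Nat.add_zero, BinOp.eval_mod, BinOp.eval_eq, BinOp.eval_band,
        BinOp.eval_shr, BinOp.eval_div, BinOp.eval_lt, BinOp.eval_add_of_lt, BinOp.eval_sub_of_le,
        BinOp.eval_mul_of_lt, hva, hvb, hvd, merge_apply_of_lt ha, merge_apply_of_lt hb, merge_apply_of_lt hd] at hv2 hR; subst hv2
    have htmp := execOps_cons_fwd hR; clear hR; obtain ⟨v3, hv3, hR⟩ := htmp
    simp -failIfUnchanged (disch := omega) only [Operand.write, Operand.read, merge_apply_of_lt,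
        merge_apply_of_le, Function.update_self, Function.update_of_ne, update_merge_of_lt,
        update_merge_of_le, Nat.add_zero, BinOp.eval_mod, BinOp.eval_eq, BinOp.eval_band,
        BinOp.eval_shr, BinOp.eval_div, BinOp.eval_lt, BinOp.eval_add_of_lt, BinOp.eval_sub_of_le,
        BinOp.eval_mul_of_lt, hva, hvb, hvd, merge_apply_of_lt ha, merge_apply_of_lt hb, merge_apply_of_lt hd] at hv3 hR; subst hv3
    simp only [execOps_nil] at hR; subst hR
    refine ⟨_, rfl, by simp, by simp, by simp, fun r hr => ?_⟩
    rw [Function.update_of_ne (by omega), Function.update_of_ne (by omega), Function.update_of_ne (by omega)]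
  exact ⟨S₁, hex₁, h⟩

set_option linter.unusedSimpArgs false in
/-- Writing the code of the current cell and advancing (`writeOps`). [folklore] -/
theorem write_spec {S H : ℕ → ℕ} {qs : List (List ℕ)} {pQ1 m cnt code : ℕ} (h34 : S 34 = pQ1) (h60 : S 60 = m)
    (h61 : S 61 = cnt) (h69 : S 69 = code) (hpQ1 : 100 ≤ pQ1) (hcnt : 1 ≤ cnt) (hw : pQ1 + m + 1 < 2 ^ w)
    (hcw : code < 2 ^ w) (hcntw : cnt < 2 ^ w) :
    ∃ S₁, Exec w O (block writeOps) ⟨merge S H, qs⟩ ⟨merge S₁ (Function.update H (pQ1 + m) code), qs⟩ 4 ∧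
      S₁ 60 = m + 1 ∧ S₁ 61 = cnt - 1 ∧ ∀ r, r ≠ 60 → r ≠ 61 → r ≠ 78 → S₁ r = S r := by
  obtain ⟨st₁, hex₁, S₁, rfl, h⟩ : ∃ st₁, Exec w O (block writeOps) ⟨merge S H, qs⟩ st₁ 4 ∧
      ∃ S₁, st₁ = ⟨merge S₁ (Function.update H (pQ1 + m) code), qs⟩ ∧ (S₁ 60 = m + 1 ∧ S₁ 61 = cnt - 1 ∧
        ∀ r, r ≠ 60 → r ≠ 61 → r ≠ 78 → S₁ r = S r) := by
    refine Exec.block_of_fwd _ _ fun R hR => ?_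
    unfold writeOps at hR
    have htmp := execOps_cons_fwd hR; clear hR; obtain ⟨v1, hv1, hR⟩ := htmp
    simp -failIfUnchanged (disch := omega) only [Operand.write, Operand.read, merge_apply_of_lt,
        merge_apply_of_le, Function.update_self, Function.update_of_ne, update_merge_of_lt,
        update_merge_of_le, Nat.add_zero, BinOp.eval_mod, BinOp.eval_eq, BinOp.eval_band,
        BinOp.eval_shr, BinOp.eval_div, BinOp.eval_lt, BinOp.eval_add_of_lt, BinOp.eval_sub_of_le,
        BinOp.eval_mul_of_lt, h34, h60, h61, h69] at hv1 hR; subst hv1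
    have htmp := execOps_cons_fwd hR; clear hR; obtain ⟨v2, hv2, hR⟩ := htmp
    simp -failIfUnchanged (disch := omega) only [Operand.write, Operand.read, merge_apply_of_lt,
        merge_apply_of_le, Function.update_self, Function.update_of_ne, update_merge_of_lt,
        update_merge_of_le, Nat.add_zero, BinOp.eval_mod, BinOp.eval_eq, BinOp.eval_band,
        BinOp.eval_shr, BinOp.eval_div, BinOp.eval_lt, BinOp.eval_add_of_lt, BinOp.eval_sub_of_le,
        BinOp.eval_mul_of_lt, h34, h60, h61, h69] at hv2 hR; subst hv2
    have htmp := execOps_cons_fwd hR; clear hR; obtain ⟨v3, hv3, hR⟩ := htmp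
    simp -failIfUnchanged (disch := omega) only [Operand.write, Operand.read, merge_apply_of_lt,
        merge_apply_of_le, Function.update_self, Function.update_of_ne, update_merge_of_lt,
        update_merge_of_le, Nat.add_zero, BinOp.eval_mod, BinOp.eval_eq, BinOp.eval_band,
        BinOp.eval_shr, BinOp.eval_div, BinOp.eval_lt, BinOp.eval_add_of_lt, BinOp.eval_sub_of_le,
        BinOp.eval_mul_of_lt, h34, h60, h61, h69] at hv3 hR; subst hv3
    have htmp := execOps_cons_fwd hR; clear hR; obtain ⟨v4, hv4, hR⟩ := htmp
    simp -failIfUnchanged (disch := omega) only [Operand.write, Operand.read, merge_apply_of_lt,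
        merge_apply_of_le, Function.update_self, Function.update_of_ne, update_merge_of_lt,
        update_merge_of_le, Nat.add_zero, BinOp.eval_mod, BinOp.eval_eq, BinOp.eval_band,
        BinOp.eval_shr, BinOp.eval_div, BinOp.eval_lt, BinOp.eval_add_of_lt, BinOp.eval_sub_of_le,
        BinOp.eval_mul_of_lt, h34, h60, h61, h69] at hv4 hR; subst hv4
    simp only [execOps_nil] at hR; subst hR
    refine ⟨_, rfl, by simp, by simp, fun r h1 h2 h3 => ?_⟩
    rw [Function.update_of_ne h2, Function.update_of_ne h1, Function.update_of_ne h3]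
  exact ⟨S₁, hex₁, h⟩

/-- Every cell code is at most the non-edge code. [folklore] -/
theorem qcode_le (q : QData n) (hX : HasBoundedWeights q.X q.M) (hY : HasBoundedWeights q.Y q.M)
    (hlo : ∀ t, t < n * n → q.lo t + q.pw ≤ 8 * q.M + 2) (hL : 0 < q.L) {m : ℕ} (hm : m < 9 * (q.L * q.L)) :
    qcode q m ≤ 2 * big q.M + 1 := by
  have h3L : 0 < 3 * q.L := by omega
  have hu : m / (3 * q.L) < 3 * q.L := Nat.div_lt_of_lt_mul (by nlinarith)
  have hv : m % (3 * q.L) < 3 * q.L := Nat.mod_lt _ h3L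
  have habs : |q.qmatN (m / (3 * q.L)) (m % (3 * q.L))| ≤ big q.M := q.abs_qmat_le hX hY hlo ⟨_, hu⟩ ⟨_, hv⟩
  have hna : (q.qmatN (m / (3 * q.L)) (m % (3 * q.L))).natAbs ≤ big q.M := by
    have : ((q.qmatN (m / (3 * q.L)) (m % (3 * q.L))).natAbs : ℤ) ≤ big q.M := by rwa [Int.natCast_natAbs]
    exact_mod_cast this
  unfold qcode
  exact le_trans (encodeWithTopInt_coe_le _) (by omega)

/-- **One cell of the query matrix is computed correctly**: from a store with the constant and query
registers in place, the data invariant, the cell counter `r60 = m < 9L²` and `r61 = 9L² - m`,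
`cellBody` writes `qcode q m` at `pQ + 1 + m`, advances the counters, and touches no register below
`20` or in `[40, 60)` and no constant or query register, within `95` steps. [folklore] -/
theorem cellBody_spec (hG : Geo n w F pX pY q.M) (hQ : QFacts c' q pX pY H₀)
    (hfdb : ∀ t, t < n * n → q.fd t ≤ 8 * q.M + 2) {S H : ℕ → ℕ} {qs : List (List ℕ)}
    (hK : KRegs n F pX pY q.M q.L (nblk n) q.pw S) (hW : WRegs q.bi q.bj q.bk q.rlo q.rhi q.clo q.chi S)
    (hD : DataQ q F H₀ H) {m : ℕ} (hm : m < 9 * (q.L * q.L)) (h60 : S 60 = m)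
    (h61 : S 61 = 9 * (q.L * q.L) - m) :
    ∃ S', ExecLE w O cellBody ⟨merge S H, qs⟩
        ⟨merge S' (Function.update H (F + 2 * (n * n) + 1 + m) (qcode q m)), qs⟩ 95 ∧
      KRegs n F pX pY q.M q.L (nblk n) q.pw S' ∧ WRegs q.bi q.bj q.bk q.rlo q.rhi q.clo q.chi S' ∧
      S' 60 = m + 1 ∧ S' 61 = 9 * (q.L * q.L) - (m + 1) ∧ ∀ r, r < 60 → (r < 20 ∨ 40 ≤ r) → S' r = S r := by
  obtain ⟨hn, hpX, hpY, hpYF, hFw, hMw, hn3w⟩ := id hG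
  have hwsp : wspNT n = 2 * (n * n) + 9 * (q.L * q.L) + 3 := by rw [hQ.hL]; rfl
  have hL1 : 1 ≤ q.L := hQ.hL ▸ one_le_cubeRt hn
  have hLn : q.L ≤ n := hQ.hL ▸ cubeRt_le n
  have hLL : q.L * q.L ≤ n * n := Nat.mul_le_mul hLn hLn
  have hbiL : q.bi * q.L < n := by rw [hQ.hL]; exact blk_mul_lt hn hQ.hbi
  have hbjL : q.bj * q.L < n := by rw [hQ.hL]; exact blk_mul_lt hn hQ.hbj
  have hbkL : q.bk * q.L < n := by rw [hQ.hL]; exact blk_mul_lt hn hQ.hbk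
  have hnb : nblk n ≤ n := nblk_le hn
  have hbi' : q.bi < n := lt_of_lt_of_le hQ.hbi hnb
  have hbj' : q.bj < n := lt_of_lt_of_le hQ.hbj hnb
  have hbk' : q.bk < n := lt_of_lt_of_le hQ.hbk hnb
  have hnn : n ≤ n * n := Nat.le_mul_self n
  have hX : MatAt H pX q.X := hD.matAt_X hG hQ.hX0
  have hY : MatAt H pY q.Y := hD.matAt_Y hG hQ.hY0
  have h3L : 0 < 3 * q.L := by omega
  have hiu : m / (3 * q.L) % q.L < q.L := Nat.mod_lt _ hL1
  have hiv : m % (3 * q.L) % q.L < q.L := Nat.mod_lt _ hL1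
  have hcode : qcode q m < 2 ^ w :=
    lt_of_le_of_lt (qcode_le q hQ.ok.hX hQ.ok.hY hQ.ok.hlo hL1 hm) hMw
  have hqc := qcode_eq q hL1 hm
  -- decode
  obtain ⟨S₁, hex₁, h65, h67, h68, h69, hS₁⟩ := decodeCell_spec (w := w) (O := O) (H := H) (qs := qs) hL1 hm hMw
    hK.r23 hK.r25 hK.r26 h60
  have hK₁ : KRegs n F pX pY q.M q.L (nblk n) q.pw S₁ := hK.of_agree fun r hr => hS₁ r (by omega)
  have hW₁ : WRegs q.bi q.bj q.bk q.rlo q.rhi q.clo q.chi S₁ := hW.of_agree fun r hr _ => hS₁ r (by omega)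
  have h60₁ : S₁ 60 = m := (hS₁ 60 (by omega)).trans h60
  have h61₁ : S₁ 61 = 9 * (q.L * q.L) - m := (hS₁ 61 (by omega)).trans h61
  set sel := 3 * (m / (3 * q.L) / q.L) + m % (3 * q.L) / q.L with hsel
  -- guard 1
  obtain ⟨S₂, hex₂, h70₂, hS₂⟩ := guard_spec (w := w) (O := O) (H := H) (qs := qs) 1 h68
  have hK₂ : KRegs n F pX pY q.M q.L (nblk n) q.pw S₂ := hK₁.of_agree fun r hr => hS₂ r (by omega)
  have hW₂ : WRegs q.bi q.bj q.bk q.rlo q.rhi q.clo q.chi S₂ := hW₁.of_agree fun r hr _ => hS₂ r (by omega)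
  by_cases h1 : sel = 1
  · -- an `X`-arc
    have h70' : (Operand.dir 70).read (merge S₂ H) ≠ 0 := by
      rw [Operand.read_dir_merge (by norm_num), h70₂, if_pos h1]; exact one_ne_zero
    obtain ⟨S₃, hex₃, h71, h72, h73, hS₃⟩ := sel_spec (w := w) (O := O) (H := H) (qs := qs) (a := 42) (b := 44)
      (d := 37) (by norm_num) (by norm_num) (by norm_num) hW₂.r42 hW₂.r44 hK₂.r37 (by omega) (by omega)
      (by omega) (by norm_num) (by norm_num)
    have hK₃ : KRegs n F pX pY q.M q.L (nblk n) q.pw S₃ := hK₂.of_agree fun r hr => hS₃ r (by omega)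
    have hW₃ : WRegs q.bi q.bj q.bk q.rlo q.rhi q.clo q.chi S₃ := hW₂.of_agree fun r hr _ => hS₃ r (by omega)
    obtain ⟨S₄, hex₄, h69₄, hS₄⟩ := arcXY_spec (w := w) (O := O) (qs := qs) hG hX hQ.ok.hX hpX (by omega) hbiL
      hbkL hiu hiv hLn hK₃.r2 hK₃.r25 ((hS₃ 65 (by omega)).trans ((hS₂ 65 (by omega)).trans h65))
      ((hS₃ 67 (by omega)).trans ((hS₂ 67 (by omega)).trans h67))
      ((hS₃ 69 (by omega)).trans ((hS₂ 69 (by omega)).trans h69)) h71 h72 h73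
    have hK₄ : KRegs n F pX pY q.M q.L (nblk n) q.pw S₄ := hK₃.of_agree fun r hr => hS₄ r (by omega) (by omega)
    have hW₄ : WRegs q.bi q.bj q.bk q.rlo q.rhi q.clo q.chi S₄ :=
      hW₃.of_agree fun r hr hr' => hS₄ r (by omega) (by omega)
    have h68₄ : S₄ 68 = sel := by
      rw [hS₄ 68 (by omega) (by omega), hS₃ 68 (by omega), hS₂ 68 (by omega), h68]
    have hcode₄ : S₄ 69 = qcode q m := by rw [h69₄, hqc, if_pos h1]; rfl
    -- guards 5 and 6 fail
    obtain ⟨S₅, hex₅, h70₅, hS₅⟩ := guard_spec (w := w) (O := O) (H := H) (qs := qs) 5 h68₄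
    have h70₅' : (Operand.dir 70).read (merge S₅ H) = 0 := by
      rw [Operand.read_dir_merge (by norm_num), h70₅, if_neg (by omega)]
    obtain ⟨S₆, hex₆, h70₆, hS₆⟩ := guard_spec (w := w) (O := O) (H := H) (qs := qs) 6 ((hS₅ 68 (by omega)).trans h68₄)
    have h70₆' : (Operand.dir 70).read (merge S₆ H) = 0 := by
      rw [Operand.read_dir_merge (by norm_num), h70₆, if_neg (by omega)]
    have hK₆ : KRegs n F pX pY q.M q.L (nblk n) q.pw S₆ :=
      (hK₄.of_agree fun r hr => hS₅ r (by omega)).of_agree fun r hr => hS₆ r (by omega)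
    have hW₆ : WRegs q.bi q.bj q.bk q.rlo q.rhi q.clo q.chi S₆ :=
      (hW₄.of_agree fun r hr _ => hS₅ r (by omega)).of_agree fun r hr _ => hS₆ r (by omega)
    -- write
    obtain ⟨S₇, hex₇, h60₇, h61₇, hS₇⟩ := write_spec (w := w) (O := O) (H := H) (qs := qs) hK₆.r34
      (((hS₆ 60 (by omega)).trans (hS₅ 60 (by omega))).trans
        (((hS₄ 60 (by omega) (by omega)).trans (hS₃ 60 (by omega))).trans ((hS₂ 60 (by omega)).trans h60₁)))
      (((hS₆ 61 (by omega)).trans (hS₅ 61 (by omega))).trans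
        (((hS₄ 61 (by omega) (by omega)).trans (hS₃ 61 (by omega))).trans ((hS₂ 61 (by omega)).trans h61₁)))
      (((hS₆ 69 (by omega)).trans (hS₅ 69 (by omega))).trans hcode₄) (by omega) (by omega) (by omega) hcode
      (by omega)
    refine ⟨S₇, ?_, hK₆.of_agree fun r hr => hS₇ r (by omega) (by omega) (by omega),
      hW₆.of_agree fun r hr hr' => hS₇ r (by omega) (by omega) (by omega), h60₇, by omega, fun r hr hr' => ?_⟩
    · refine ExecLE.mono (show ExecLE w O cellBody _ _ _ from hex₁.execLE.seqs_cons (hex₂.execLE.seqs_cons ((ExecLE.ifz_ne h70' (hex₃.execLE.seq hex₄)).seqs_cons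
        (hex₅.execLE.seqs_cons ((ExecLE.ifz_zero h70₅' (ExecLE.skip _ 0)).seqs_cons
        (hex₆.execLE.seqs_cons ((ExecLE.ifz_zero h70₆' (ExecLE.skip _ 0)).seqs_cons
        (ExecLE.seqs_one hex₇.execLE)))))))) (by norm_num)
    · rw [hS₇ r (by omega) (by omega) (by omega), hS₆ r (by omega), hS₅ r (by omega), hS₄ r (by omega) (by omega),
        hS₃ r (by omega), hS₂ r (by omega), hS₁ r (by omega)]
  -- guard 1 fails
  have h70' : (Operand.dir 70).read (merge S₂ H) = 0 := by
    rw [Operand.read_dir_merge (by norm_num), h70₂, if_neg h1]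
  have h68₂ : S₂ 68 = sel := (hS₂ 68 (by omega)).trans h68
  obtain ⟨S₃, hex₃, h70₃, hS₃⟩ := guard_spec (w := w) (O := O) (H := H) (qs := qs) 5 h68₂
  have hK₃ : KRegs n F pX pY q.M q.L (nblk n) q.pw S₃ := hK₂.of_agree fun r hr => hS₃ r (by omega)
  have hW₃ : WRegs q.bi q.bj q.bk q.rlo q.rhi q.clo q.chi S₃ := hW₂.of_agree fun r hr _ => hS₃ r (by omega)
  have h65₃ : S₃ 65 = m / (3 * q.L) % q.L := by rw [hS₃ 65 (by omega), hS₂ 65 (by omega), h65]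
  have h67₃ : S₃ 67 = m % (3 * q.L) % q.L := by rw [hS₃ 67 (by omega), hS₂ 67 (by omega), h67]
  have h69₃ : S₃ 69 = 2 * big q.M + 1 := by rw [hS₃ 69 (by omega), hS₂ 69 (by omega), h69]
  have h60₃ : S₃ 60 = m := by rw [hS₃ 60 (by omega), hS₂ 60 (by omega), h60₁]
  have h61₃ : S₃ 61 = 9 * (q.L * q.L) - m := by rw [hS₃ 61 (by omega), hS₂ 61 (by omega), h61₁]
  have h68₃ : S₃ 68 = sel := (hS₃ 68 (by omega)).trans h68₂
  by_cases h5 : sel = 5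
  · -- a `Y`-arc
    have h70₃' : (Operand.dir 70).read (merge S₃ H) ≠ 0 := by
      rw [Operand.read_dir_merge (by norm_num), h70₃, if_pos h5]; exact one_ne_zero
    obtain ⟨S₄, hex₄, h71, h72, h73, hS₄⟩ := sel_spec (w := w) (O := O) (H := H) (qs := qs) (a := 44) (b := 43)
      (d := 38) (by norm_num) (by norm_num) (by norm_num) hW₃.r44 hW₃.r43 hK₃.r38 (by omega) (by omega)
      (by omega) (by norm_num) (by norm_num)
    have hK₄ : KRegs n F pX pY q.M q.L (nblk n) q.pw S₄ := hK₃.of_agree fun r hr => hS₄ r (by omega)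
    have hW₄ : WRegs q.bi q.bj q.bk q.rlo q.rhi q.clo q.chi S₄ := hW₃.of_agree fun r hr _ => hS₄ r (by omega)
    obtain ⟨S₅, hex₅, h69₅, hS₅⟩ := arcXY_spec (w := w) (O := O) (qs := qs) hG hY hQ.ok.hY (by omega) (by omega)
      hbkL hbjL hiu hiv hLn hK₄.r2 hK₄.r25 ((hS₄ 65 (by omega)).trans h65₃) ((hS₄ 67 (by omega)).trans h67₃)
      ((hS₄ 69 (by omega)).trans h69₃) h71 h72 h73
    have hK₅ : KRegs n F pX pY q.M q.L (nblk n) q.pw S₅ := hK₄.of_agree fun r hr => hS₅ r (by omega) (by omega)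
    have hW₅ : WRegs q.bi q.bj q.bk q.rlo q.rhi q.clo q.chi S₅ :=
      hW₄.of_agree fun r hr hr' => hS₅ r (by omega) (by omega)
    have h68₅ : S₅ 68 = sel := by rw [hS₅ 68 (by omega) (by omega), hS₄ 68 (by omega), h68₃]
    have hcode₅ : S₅ 69 = qcode q m := by rw [h69₅, hqc, if_neg h1, if_pos h5]; rfl
    obtain ⟨S₆, hex₆, h70₆, hS₆⟩ := guard_spec (w := w) (O := O) (H := H) (qs := qs) 6 h68₅
    have h70₆' : (Operand.dir 70).read (merge S₆ H) = 0 := by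
      rw [Operand.read_dir_merge (by norm_num), h70₆, if_neg (by omega)]
    have hK₆ : KRegs n F pX pY q.M q.L (nblk n) q.pw S₆ := hK₅.of_agree fun r hr => hS₆ r (by omega)
    have hW₆ : WRegs q.bi q.bj q.bk q.rlo q.rhi q.clo q.chi S₆ := hW₅.of_agree fun r hr _ => hS₆ r (by omega)
    obtain ⟨S₇, hex₇, h60₇, h61₇, hS₇⟩ := write_spec (w := w) (O := O) (H := H) (qs := qs) hK₆.r34
      ((hS₆ 60 (by omega)).trans (((hS₅ 60 (by omega) (by omega)).trans (hS₄ 60 (by omega))).trans h60₃))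
      ((hS₆ 61 (by omega)).trans (((hS₅ 61 (by omega) (by omega)).trans (hS₄ 61 (by omega))).trans h61₃))
      ((hS₆ 69 (by omega)).trans hcode₅) (by omega) (by omega) (by omega) hcode (by omega)
    refine ⟨S₇, ?_, hK₆.of_agree fun r hr => hS₇ r (by omega) (by omega) (by omega),
      hW₆.of_agree fun r hr hr' => hS₇ r (by omega) (by omega) (by omega), h60₇, by omega, fun r hr hr' => ?_⟩
    · refine ExecLE.mono (show ExecLE w O cellBody _ _ _ from hex₁.execLE.seqs_cons (hex₂.execLE.seqs_cons ((ExecLE.ifz_zero h70' (ExecLE.skip _ 0)).seqs_cons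
        (hex₃.execLE.seqs_cons ((ExecLE.ifz_ne h70₃' (hex₄.execLE.seq hex₅)).seqs_cons
        (hex₆.execLE.seqs_cons ((ExecLE.ifz_zero h70₆' (ExecLE.skip _ 0)).seqs_cons
        (ExecLE.seqs_one hex₇.execLE)))))))) (by norm_num)
    · rw [hS₇ r (by omega) (by omega) (by omega), hS₆ r (by omega), hS₅ r (by omega) (by omega), hS₄ r (by omega),
        hS₃ r (by omega), hS₂ r (by omega), hS₁ r (by omega)]
  -- guard 5 fails
  have h70₃' : (Operand.dir 70).read (merge S₃ H) = 0 := by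
    rw [Operand.read_dir_merge (by norm_num), h70₃, if_neg h5]
  obtain ⟨S₄, hex₄, h70₄, hS₄⟩ := guard_spec (w := w) (O := O) (H := H) (qs := qs) 6 h68₃
  have hK₄ : KRegs n F pX pY q.M q.L (nblk n) q.pw S₄ := hK₃.of_agree fun r hr => hS₄ r (by omega)
  have hW₄ : WRegs q.bi q.bj q.bk q.rlo q.rhi q.clo q.chi S₄ := hW₃.of_agree fun r hr _ => hS₄ r (by omega)
  by_cases h6 : sel = 6
  · -- a back arc
    have h70₄' : (Operand.dir 70).read (merge S₄ H) ≠ 0 := by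
      rw [Operand.read_dir_merge (by norm_num), h70₄, if_pos h6]; exact one_ne_zero
    obtain ⟨S₅, hex₅, h69₅, hS₅⟩ := arcT_spec (w := w) (O := O) (qs := qs) hG hQ.ok hD hfdb hbiL hbjL hiu hiv hLn
      hK₄.r2 hK₄.r21 hK₄.r24 hK₄.r25 hK₄.r31 hK₄.r32 hW₄.r42 hW₄.r43 hW₄.r45 hW₄.r46 hW₄.r47 hW₄.r48
      ((hS₄ 65 (by omega)).trans h65₃) ((hS₄ 67 (by omega)).trans h67₃) ((hS₄ 69 (by omega)).trans h69₃)
    have hK₅ : KRegs n F pX pY q.M q.L (nblk n) q.pw S₅ := hK₄.of_agree fun r hr => hS₅ r (by omega) (by omega)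
    have hW₅ : WRegs q.bi q.bj q.bk q.rlo q.rhi q.clo q.chi S₅ :=
      hW₄.of_agree fun r hr hr' => hS₅ r (by omega) (by omega)
    have hcode₅ : S₅ 69 = qcode q m := by rw [h69₅, hqc, if_neg h1, if_neg h5, if_pos h6]
    obtain ⟨S₇, hex₇, h60₇, h61₇, hS₇⟩ := write_spec (w := w) (O := O) (H := H) (qs := qs) hK₅.r34
      (((hS₅ 60 (by omega) (by omega)).trans (hS₄ 60 (by omega))).trans h60₃)
      (((hS₅ 61 (by omega) (by omega)).trans (hS₄ 61 (by omega))).trans h61₃)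
      hcode₅ (by omega) (by omega) (by omega) hcode (by omega)
    refine ⟨S₇, ?_, hK₅.of_agree fun r hr => hS₇ r (by omega) (by omega) (by omega),
      hW₅.of_agree fun r hr hr' => hS₇ r (by omega) (by omega) (by omega), h60₇, by omega, fun r hr hr' => ?_⟩
    · refine ExecLE.mono (show ExecLE w O cellBody _ _ _ from hex₁.execLE.seqs_cons (hex₂.execLE.seqs_cons ((ExecLE.ifz_zero h70' (ExecLE.skip _ 0)).seqs_cons
        (hex₃.execLE.seqs_cons ((ExecLE.ifz_zero h70₃' (ExecLE.skip _ 0)).seqs_cons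
        (hex₄.execLE.seqs_cons ((ExecLE.ifz_ne h70₄' hex₅).seqs_cons
        (ExecLE.seqs_one hex₇.execLE)))))))) (by norm_num)
    · rw [hS₇ r (by omega) (by omega) (by omega), hS₅ r (by omega) (by omega), hS₄ r (by omega),
        hS₃ r (by omega), hS₂ r (by omega), hS₁ r (by omega)]
  · -- a non-edge
    have h70₄' : (Operand.dir 70).read (merge S₄ H) = 0 := by
      rw [Operand.read_dir_merge (by norm_num), h70₄, if_neg h6]
    have hcode₄ : S₄ 69 = qcode q m := by rw [hS₄ 69 (by omega), h69₃, hqc, if_neg h1, if_neg h5, if_neg h6]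
    obtain ⟨S₇, hex₇, h60₇, h61₇, hS₇⟩ := write_spec (w := w) (O := O) (H := H) (qs := qs) hK₄.r34
      ((hS₄ 60 (by omega)).trans h60₃) ((hS₄ 61 (by omega)).trans h61₃)
      hcode₄ (by omega) (by omega) (by omega) hcode (by omega)
    refine ⟨S₇, ?_, hK₄.of_agree fun r hr => hS₇ r (by omega) (by omega) (by omega),
      hW₄.of_agree fun r hr hr' => hS₇ r (by omega) (by omega) (by omega), h60₇, by omega, fun r hr hr' => ?_⟩
    · refine ExecLE.mono (show ExecLE w O cellBody _ _ _ from hex₁.execLE.seqs_cons (hex₂.execLE.seqs_cons ((ExecLE.ifz_zero h70' (ExecLE.skip _ 0)).seqs_cons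
        (hex₃.execLE.seqs_cons ((ExecLE.ifz_zero h70₃' (ExecLE.skip _ 0)).seqs_cons
        (hex₄.execLE.seqs_cons ((ExecLE.ifz_zero h70₄' (ExecLE.skip _ 0)).seqs_cons
        (ExecLE.seqs_one hex₇.execLE)))))))) (by norm_num)
    · rw [hS₇ r (by omega) (by omega) (by omega), hS₄ r (by omega), hS₃ r (by omega), hS₂ r (by omega), hS₁ r (by omega)]

end Cell


section Ask

variable {w : ℕ} {O : List ℕ → List ℕ} {F pX pY : ℕ} {c' : ℕ} {q : QData n} {H₀ : ℕ → ℕ}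

/-- The running time of one query on blocks of side `L`: `97 · 9L² + 7`. [folklore] -/
def tAsk (L : ℕ) : ℕ := 9 * (L * L) * 97 + 7

/-- The invariant of the cell loop after `j` cells. [folklore] -/
def CInv (q : QData n) (F pX pY : ℕ) (H₀ S₀ : ℕ → ℕ) (qs : List (List ℕ)) (j : ℕ) (st : Store) : Prop :=
  ∃ S H, st = ⟨merge S H, qs⟩ ∧ KRegs n F pX pY q.M q.L (nblk n) q.pw S ∧
    WRegs q.bi q.bj q.bk q.rlo q.rhi q.clo q.chi S ∧ S 60 = j ∧ S 61 = 9 * (q.L * q.L) - j ∧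
    (∀ r, r < 60 → (r < 20 ∨ 40 ≤ r) → S r = S₀ r) ∧ DataQ q F H₀ H ∧ H (F + 2 * (n * n)) = 3 * q.L ∧
    ∀ m, m < j → H (F + 2 * (n * n) + 1 + m) = qcode q m

/-- **The cell loop** fills the query buffer with the codes of all `9L²` cells. [folklore] -/
theorem cellLoop_spec (hG : Geo n w F pX pY q.M) (hQ : QFacts c' q pX pY H₀)
    (hfdb : ∀ t, t < n * n → q.fd t ≤ 8 * q.M + 2) {S₀ : ℕ → ℕ} {qs : List (List ℕ)} {st : Store}
    (hst : CInv q F pX pY H₀ S₀ qs 0 st) :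
    ∃ st', ExecLE w O (whilenz (.dir 61) cellBody) st st' (9 * (q.L * q.L) * (95 + 2) + 1) ∧
      CInv q F pX pY H₀ S₀ qs (9 * (q.L * q.L)) st' := by
  have hwsp : wspNT n = 2 * (n * n) + 9 * (q.L * q.L) + 3 := by rw [hQ.hL]; rfl
  refine ExecLE.whilenz_invariant (9 * (q.L * q.L)) 95 (CInv q F pX pY H₀ S₀ qs) (fun j hj st hst => ?_) ?_ hst
  · obtain ⟨S, H, rfl, hK, hW, h60, h61, hfr, hD, hhd, hcells⟩ := hst
    refine ⟨?_, ?_⟩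
    · show merge S H 61 ≠ 0
      rw [merge_apply_of_lt (by norm_num), h61]; omega
    · obtain ⟨S', hex, hK', hW', h60', h61', hfr'⟩ := cellBody_spec hG hQ hfdb hK hW hD hj h60 h61
      refine ⟨_, hex, S', _, rfl, hK', hW', h60', h61', fun r hr hr' => (hfr' r hr hr').trans (hfr r hr hr'),
        hD.update (by omega) (by omega) _, ?_, fun m hm => ?_⟩
      · rw [Function.update_of_ne (by omega)]; exact hhd
      · rcases Nat.lt_succ_iff_lt_or_eq.1 hm with hm | rfl
        · rw [Function.update_of_ne (by omega)]; exact hcells m hm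
        · rw [Function.update_self]
  · intro st hst
    obtain ⟨S, H, rfl, -, -, -, h61, -⟩ := hst
    show merge S H 61 = 0
    rw [merge_apply_of_lt (by norm_num), h61]; omega

/-- Writing the oracle's one-word answer keeps the data invariant. [folklore] -/
theorem DataQ.segWrite_ans {F : ℕ} {H₀ H : ℕ → ℕ} (h : DataQ q F H₀ H) (hL : q.L = cubeRt n) (a : ℕ) :
    DataQ q F H₀ (segWrite H (F + 2 * (n * n) + (9 * (q.L * q.L) + 1)) [a]) := by
  have hwsp : wspNT n = 2 * (n * n) + 9 * (q.L * q.L) + 3 := by rw [hL]; rfl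
  have key : ∀ b, b < F + 2 * (n * n) ∨ F + wspNT n ≤ b →
      segWrite H (F + 2 * (n * n) + (9 * (q.L * q.L) + 1)) [a] b = H b := by
    intro b hb
    unfold segWrite
    rw [if_neg (by omega), if_neg (by simp; omega)]
  exact ⟨fun b hb => (key b (by omega)).trans (h.below b hb), fun t ht => (key _ (by omega)).trans (h.lo t ht),
    fun t ht => (key _ (by omega)).trans (h.fd t ht), fun b hb => (key b (Or.inr hb)).trans (h.zero b hb)⟩

set_option linter.unusedSimpArgs false in
/-- **One detection query, end to end.** From a store holding the constant registers, the triple and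
the windows of `q`, and the data invariant, `ask` appends to the query log exactly the encoding of
the Negative-Triangle instance `q.qmat` (size `3L`), leaves the answer bit `ansOf q` (`1` iff the
query graph has a witness, `QData.hasNegativeTriangle_qmat_iff`) in `r49`, keeps the constant and
query registers, the registers below `20` and `40 … 59` other than `49`, and keeps the data invariant, within
`tAsk L` steps. [folklore] -/
theorem ask_spec (hG : Geo n w F pX pY q.M) (hQ : QFacts c' q pX pY H₀)
    (hfdb : ∀ t, t < n * n → q.fd t ≤ 8 * q.M + 2) (hO : (NegativeTriangle c').OracleAnswers O)
    {S H : ℕ → ℕ} {qs : List (List ℕ)} (hK : KRegs n F pX pY q.M q.L (nblk n) q.pw S)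
    (hW : WRegs q.bi q.bj q.bk q.rlo q.rhi q.clo q.chi S) (hD : DataQ q F H₀ H) :
    ∃ S' H', ExecLE w O ask ⟨merge S H, qs⟩
        ⟨merge S' H', qs ++ [(NegativeTriangle c').encode hQ.ok.inst]⟩ (tAsk q.L) ∧
      KRegs n F pX pY q.M q.L (nblk n) q.pw S' ∧ WRegs q.bi q.bj q.bk q.rlo q.rhi q.clo q.chi S' ∧
      S' 49 = ansOf q ∧ (∀ r, r < 60 → (r < 20 ∨ 40 ≤ r) → r ≠ 49 → S' r = S r) ∧ DataQ q F H₀ H' := by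
  obtain ⟨hn, hpX, hpY, hpYF, hFw, hMw, hn3w⟩ := id hG
  have hwsp : wspNT n = 2 * (n * n) + 9 * (q.L * q.L) + 3 := by rw [hQ.hL]; rfl
  have hL1 : 1 ≤ q.L := hQ.hL ▸ one_le_cubeRt hn
  have hLn : q.L ≤ n := hQ.hL ▸ cubeRt_le n
  have hLL : q.L * q.L ≤ n * n := Nat.mul_le_mul hLn hLn
  have hnn : n ≤ n * n := Nat.le_mul_self n
  obtain ⟨h2, h9, h16, h17, h20, h21, h22, h23, h24, h25, h26, h27, h28, h29, h30, h31, h32, h33, h34,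
    h35, h36, h37, h38, h39⟩ := id hK
  -- the three set-up instructions
  obtain ⟨st₁, hex₁, S₁, rfl, h60, h61, hS₁, hhd⟩ : ∃ st₁, Exec w O (block [(.add, .dir 60, .imm 0, .imm 0),
      (.add, .dir 61, .dir 39, .imm 0), (.add, .ind 33, .dir 26, .imm 0)]) ⟨merge S H, qs⟩ st₁ 3 ∧
      ∃ S₁, st₁ = ⟨merge S₁ (Function.update H (F + 2 * (n * n)) (3 * q.L)), qs⟩ ∧ S₁ 60 = 0 ∧
        S₁ 61 = 9 * (q.L * q.L) ∧ (∀ r, r ≠ 60 → r ≠ 61 → S₁ r = S r) ∧ True := by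
    refine Exec.block_of_fwd _ _ fun R hR => ?_
    have htmp := execOps_cons_fwd hR; clear hR; obtain ⟨v1, hv1, hR⟩ := htmp
    simp -failIfUnchanged (disch := omega) only [Operand.write, Operand.read, merge_apply_of_lt,
        merge_apply_of_le, Function.update_self, Function.update_of_ne, update_merge_of_lt,
        update_merge_of_le, Nat.add_zero, BinOp.eval_mod, BinOp.eval_eq, BinOp.eval_band,
        BinOp.eval_shr, BinOp.eval_div, BinOp.eval_lt, BinOp.eval_add_of_lt, BinOp.eval_sub_of_le,
        BinOp.eval_mul_of_lt, h39, h33, h26] at hv1 hR; subst hv1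
    have htmp := execOps_cons_fwd hR; clear hR; obtain ⟨v2, hv2, hR⟩ := htmp
    simp -failIfUnchanged (disch := omega) only [Operand.write, Operand.read, merge_apply_of_lt,
        merge_apply_of_le, Function.update_self, Function.update_of_ne, update_merge_of_lt,
        update_merge_of_le, Nat.add_zero, BinOp.eval_mod, BinOp.eval_eq, BinOp.eval_band,
        BinOp.eval_shr, BinOp.eval_div, BinOp.eval_lt, BinOp.eval_add_of_lt, BinOp.eval_sub_of_le,
        BinOp.eval_mul_of_lt, h39, h33, h26] at hv2 hR; subst hv2
    have htmp := execOps_cons_fwd hR; clear hR; obtain ⟨v3, hv3, hR⟩ := htmp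
    simp -failIfUnchanged (disch := omega) only [Operand.write, Operand.read, merge_apply_of_lt,
        merge_apply_of_le, Function.update_self, Function.update_of_ne, update_merge_of_lt,
        update_merge_of_le, Nat.add_zero, BinOp.eval_mod, BinOp.eval_eq, BinOp.eval_band,
        BinOp.eval_shr, BinOp.eval_div, BinOp.eval_lt, BinOp.eval_add_of_lt, BinOp.eval_sub_of_le,
        BinOp.eval_mul_of_lt, h39, h33, h26] at hv3 hR; subst hv3
    simp only [execOps_nil] at hR; subst hR
    exact ⟨_, rfl, by simp, by simp, fun r h1 h2 => by rw [Function.update_of_ne h2, Function.update_of_ne h1],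
      trivial⟩
  have hK₁ : KRegs n F pX pY q.M q.L (nblk n) q.pw S₁ := hK.of_agree fun r hr => hS₁ r (by omega) (by omega)
  have hW₁ : WRegs q.bi q.bj q.bk q.rlo q.rhi q.clo q.chi S₁ := hW.of_agree fun r hr _ => hS₁ r (by omega) (by omega)
  have hD₁ : DataQ q F H₀ (Function.update H (F + 2 * (n * n)) (3 * q.L)) := hD.update (by omega) (by omega) _
  -- the cell loop
  have hinv : CInv q F pX pY H₀ S₁ qs 0 ⟨merge S₁ (Function.update H (F + 2 * (n * n)) (3 * q.L)), qs⟩ :=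
    ⟨S₁, _, rfl, hK₁, hW₁, h60, by simpa using h61, fun r _ _ => rfl, hD₁, by simp,
      fun m hm => absurd hm (Nat.not_lt_zero m)⟩
  obtain ⟨st₂, hex₂, S₂, H₂, rfl, hK₂, hW₂, -, -, hfr₂, hD₂, hhd₂, hcells⟩ := cellLoop_spec hG hQ hfdb hinv
  -- the query
  have hseg : readSeg H₂ (F + 2 * (n * n)) (9 * (q.L * q.L) + 1) =
      encodeMatrixWithTop (q.qmat.map ((↑) : ℤ → WithTop ℤ)) := readSeg_qcode q hhd₂ hcells
  have hans : O (encodeMatrixWithTop (q.qmat.map ((↑) : ℤ → WithTop ℤ))) = [ansOf q] := hQ.ok.oracle_answer hO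
  have hans1 : ansOf q ≤ 1 := ansOf_le_one q
  have hexQ := Exec.query_dir (w := w) (O := O) (qa := 33) (ql := 27) (aa := 35) (by norm_num) (by norm_num)
    (by norm_num) (S := S₂) (by rw [hK₂.r33]; omega) (by rw [hK₂.r35]; omega) H₂ qs
  rw [hK₂.r33, hK₂.r27, hK₂.r35, hseg, hans] at hexQ
  have hmap : [ansOf q].map (· % 2 ^ w) = [ansOf q] := by
    rw [List.map_singleton, Nat.mod_eq_of_lt (by omega)]
  rw [hmap] at hexQ
  have hD₃ : DataQ q F H₀ (segWrite H₂ (F + 2 * (n * n) + (9 * (q.L * q.L) + 1)) [ansOf q]) :=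
    hD₂.segWrite_ans hQ.hL _
  have hA : segWrite H₂ (F + 2 * (n * n) + (9 * (q.L * q.L) + 1)) [ansOf q]
      (F + 2 * (n * n) + (9 * (q.L * q.L) + 1) + 1) = ansOf q := by
    unfold segWrite
    rw [if_neg (by omega), if_pos ⟨by omega, by simp⟩]
    simp
  generalize hH₃ : segWrite H₂ (F + 2 * (n * n) + (9 * (q.L * q.L) + 1)) [ansOf q] = H₃ at hexQ hD₃ hA
  generalize hqs' : qs ++ [encodeMatrixWithTop (q.qmat.map ((↑) : ℤ → WithTop ℤ))] = qs' at hexQ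
  generalize hav : ansOf q = av at hA hans1 hexQ
  -- fetching the answer bit
  have h35₂ := hK₂.r35
  obtain ⟨st₄, hex₄, S₄, rfl, h49, hS₄⟩ : ∃ st₄, Exec w O (block [(.add, .dir 78, .dir 35, .imm 1),
      (.add, .dir 49, .ind 78, .imm 0)])
      ⟨merge S₂ H₃, qs'⟩ st₄ 2 ∧
      ∃ S₄, st₄ = ⟨merge S₄ H₃, qs'⟩ ∧
        S₄ 49 = av ∧ ∀ r, r ≠ 49 → r ≠ 78 → S₄ r = S₂ r := by
    clear * - h35₂ hA hans1 hpX hpY hpYF hFw hwsp hLL hnn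
    refine Exec.block_of_fwd _ _ fun R hR => ?_
    have htmp := execOps_cons_fwd hR; clear hR; obtain ⟨v1, hv1, hR⟩ := htmp
    simp -failIfUnchanged (disch := omega) only [Operand.write, Operand.read, merge_apply_of_lt,
        merge_apply_of_le, Function.update_self, Function.update_of_ne, update_merge_of_lt,
        update_merge_of_le, Nat.add_zero, BinOp.eval_mod, BinOp.eval_eq, BinOp.eval_band,
        BinOp.eval_shr, BinOp.eval_div, BinOp.eval_lt, BinOp.eval_add_of_lt, BinOp.eval_sub_of_le,
        BinOp.eval_mul_of_lt, h35₂, hA] at hv1 hR; subst hv1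
    have htmp := execOps_cons_fwd hR; clear hR; obtain ⟨v2, hv2, hR⟩ := htmp
    simp -failIfUnchanged (disch := omega) only [Operand.write, Operand.read, merge_apply_of_lt,
        merge_apply_of_le, Function.update_self, Function.update_of_ne, update_merge_of_lt,
        update_merge_of_le, Nat.add_zero, BinOp.eval_mod, BinOp.eval_eq, BinOp.eval_band,
        BinOp.eval_shr, BinOp.eval_div, BinOp.eval_lt, BinOp.eval_add_of_lt, BinOp.eval_sub_of_le,
        BinOp.eval_mul_of_lt, h35₂, hA] at hv2 hR; subst hv2
    simp only [execOps_nil] at hR; subst hR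
    exact ⟨_, rfl, by simp, fun r h1 h2 => by rw [Function.update_of_ne h1, Function.update_of_ne h2]⟩
  refine ⟨S₄, H₃, ?_, hK₂.of_agree fun r hr => hS₄ r (by omega) (by omega),
    hW₂.of_agree fun r hr _ => hS₄ r (by omega) (by omega), h49,
    fun r hr hr' hr'' => ((hS₄ r hr'' (by omega)).trans (hfr₂ r hr hr')).trans (hS₁ r (by omega) (by omega)), hD₃⟩
  have := (hex₁.execLE.seq hex₂).seqs_cons (hexQ.execLE.seqs_cons (ExecLE.seqs_one hex₄.execLE))
  rw [hQ.ok.encode_inst, hqs']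
  refine this.mono ?_
  unfold tAsk; omega

end Ask

end Literature.Computability.FineGrained.NegTriStep
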